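import Literature.NumberTheory.LFunctions.ConnesProlateGuessHermite
import HarnessLib

/-!
# Connes' Fact 6.4 from the sup-norm prolate → Hermite asymptotics (CCM25 Lemma 7.2(i))

Third link of the in-tree reduction of Connes 2026, Fact 6.4 (= Connes–Consani–Moscovici 2025,
Lemma 7.3; tree: `prolateGuess_tendsto_riemannXi`).  `ConnesProlateGuessHermite.lean` reduced Fact
6.4 to, for `n = 0, 4`: (Sₙ) `λ·max_{[−λ,λ]}|h_{n,λ} − h_n| → 0` and (Wₙ)
`∫_0^λ|h_{n,λ}′ − h_n′|(1+x)dx → 0`.  THIS file derives both from the function-level sup-norm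
asymptotics (Sₙ) ALONE — so (W₀), (W₄) are consequences of (S₀), (S₄) — and hence from the
statement in print, `max_{[−λ,λ]}|h_{n,λ} − h_n| ≤ C_nλ^{-2}` (`n = 0, 4`) = CCM25 Lemma 7.2(i),
eq. (7.7), from Meixner–Schäfke 1954, §3.2 Satz 9 — using only the prolate equation `−((λ²−x²)f′)′ + (2πλx)²f = χf` (`IsProlateFunction.eigen`), the Hermite
equation `−g″ + 4π²x²g = μg` (`μ = 2π, 18π`), `f′(0) = 0`, evenness and the zero count:

1. `(λ²−x²)f′(x) = ∫_0^x((2πλt)² − χ)f(t)dt` (`IsProlateFunction.sqMulDeriv_eq_integral`);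
2. Green's identity `(χ − λ²μ)∫_0^λ fg = ∫_0^λ f·(x²g′)′` — the weight `λ² − x²` kills the
   boundary term at `λ`, `f′(0) = g′(0) = 0` the one at `0` (`eigen_sub_mul_integral_eq`) — whence
   the eigenvalue bound `|χ_n(λ) − 2π(2n+1)λ²| = O(1)` (`eigen_sub_le_of_supLimit`);
3. on `[0, X]`: `|f′ − g′| = O_X(λ·max|f − g| + λ^{-2})` from 1, 2 (`abs_deriv_sub_le_of_supNorm`);
4. on `[X, λ)`, past the turning point and the last zero, `(λ²−x²)f′ ≤ 0` so `f` decreases and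
   `∫_X^λ|f′|(1+x) ≤ (1+X)f(X) + ∫_X^λ f + (1+λ)|f(λ)|` (`deriv_nonpos_of_nonneg`,
   `integral_abs_deriv_mul_le`), a Gaussian tail up to `O(λ^{-1})`;
5. the zeros: `h_{0,λ}` has none (`pos_of_zero`), and the four zeros of `h_{4,λ}` are confined to
   `(−1, 1)` by the sign pattern of `h_4` at `0, ±1/2, ±1` and `zeros_card = 4`
   (`IsProlateFunction.nonneg_of_four`).

Main theorems: `prolateGuess_tendsto_riemannXi_of_supLimit` — (S₀) and (S₄)
(`λ·max_{[−λ,λ]}|h_{n,λ} − h_n| → 0`, `n = 0, 4`) imply `prolateGuess_tendsto_riemannXi`; and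
`prolateGuess_tendsto_riemannXi_of_supNorm` — CCM25 Lemma 7.2(i) for `n = 0` and `n = 4` (explicit
hypotheses `hS0`, `hS4` with rate `C_n/λ²`, stated with the tree's `IsProlateFunction`, `hermiteH0`,
`hermiteH4`) implies `prolateGuess_tendsto_riemannXi`.  With `ConnesProlateGuessError/Limit/Hermite`
this makes the whole of Connes' analytic argument for Fact 6.4 kernel-checked down to the published
PSWF asymptotics.  THIS IS NOT AN RH STATEMENT; nothing here uses or approaches RH.
-/

noncomputable section

open Real Complex Set MeasureTheory Filter Topology intervalIntegral

namespace Literature.NumberTheory.LFunctions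

namespace IsProlateFunction

variable {lam : ℝ} {n : ℕ} {f : ℝ → ℝ}

/-- `((λ²−x²)f′)′ = ((2πλx)² − χ)f` on `(−λ, λ)` (the prolate equation). [cite: Connes2026Letter, §6.3] -/
theorem hasDerivAt_sqMulDeriv (hf : IsProlateFunction lam n f) {χ : ℝ}
    (hχ : ∀ x ∈ Ioo (-lam) lam,
      -(deriv (fun y ↦ (lam ^ 2 - y ^ 2) * deriv f y) x) + (2 * π * lam * x) ^ 2 * f x = χ * f x)
    {x : ℝ} (hx : x ∈ Ioo (-lam) lam) :
    HasDerivAt (fun y ↦ (lam ^ 2 - y ^ 2) * deriv f y) (((2 * π * lam * x) ^ 2 - χ) * f x) x := by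
  have hp : HasDerivAt (fun y : ℝ ↦ lam ^ 2 - y ^ 2) (-(2 * x)) x := by
    simpa using (hasDerivAt_pow 2 x).const_sub (lam ^ 2)
  have hd : HasDerivAt (deriv f) (deriv (deriv f) x) x := (hf.differentiableAt_deriv hx).hasDerivAt
  have h : HasDerivAt (fun y ↦ (lam ^ 2 - y ^ 2) * deriv f y)
      (-(2 * x) * deriv f x + (lam ^ 2 - x ^ 2) * deriv (deriv f) x) x := hp.mul hd
  have e := hχ x hx
  rw [h.deriv] at e
  refine h.congr_deriv ?_
  linear_combination -e

/-- **The integrated prolate equation**: `(λ²−x²)f′(x) = ∫_0^x((2πλt)² − χ)f(t)dt` for `0 ≤ x < λ`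
(`f′(0) = 0`). [cite: Connes2026Letter, §6.3] -/
theorem sqMulDeriv_eq_integral (hf : IsProlateFunction lam n f) {χ : ℝ}
    (hχ : ∀ x ∈ Ioo (-lam) lam,
      -(deriv (fun y ↦ (lam ^ 2 - y ^ 2) * deriv f y) x) + (2 * π * lam * x) ^ 2 * f x = χ * f x)
    {x : ℝ} (hx : x ∈ Ico 0 lam) :
    (lam ^ 2 - x ^ 2) * deriv f x = ∫ t in (0 : ℝ)..x, ((2 * π * lam * t) ^ 2 - χ) * f t := by
  have hlam := hf.lam_pos
  have hsub : uIcc 0 x ⊆ Ioo (-lam) lam := by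
    rw [uIcc_of_le hx.1]; exact fun t ht ↦ ⟨by linarith [ht.1], lt_of_le_of_lt ht.2 hx.2⟩
  have hderiv : ∀ t ∈ uIcc 0 x, HasDerivAt (fun y ↦ (lam ^ 2 - y ^ 2) * deriv f y)
      (((2 * π * lam * t) ^ 2 - χ) * f t) t := fun t ht ↦ hf.hasDerivAt_sqMulDeriv hχ (hsub ht)
  have hcont : ContinuousOn (fun t ↦ ((2 * π * lam * t) ^ 2 - χ) * f t) (uIcc 0 x) :=
    (by fun_prop : Continuous fun t : ℝ ↦ (2 * π * lam * t) ^ 2 - χ).continuousOn.mul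
      (hf.contDiffOn.continuousOn.mono fun t ht ↦ Ioo_subset_Icc_self (hsub ht))
  rw [intervalIntegral.integral_eq_sub_of_hasDerivAt hderiv (hcont.intervalIntegrable), hf.deriv_zero]
  ring

/-- `derivWithin f [−λ,λ]` is continuous on `[−λ, λ]` and agrees with `f′` inside. [folklore] -/
theorem continuousOn_derivWithin (hf : IsProlateFunction lam n f) :
    ContinuousOn (derivWithin f (Icc (-lam) lam)) (Icc (-lam) lam) :=
  hf.contDiffOn.continuousOn_derivWithin (uniqueDiffOn_Icc (by linarith [hf.lam_pos])) (by norm_num)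

/-- Inside `(−λ, λ)` the one-sided derivative is the derivative. [folklore] -/
theorem derivWithin_eq_deriv (_hf : IsProlateFunction lam n f) {x : ℝ} (hx : x ∈ Ioo (-lam) lam) :
    derivWithin f (Icc (-lam) lam) x = deriv f x :=
  derivWithin_of_mem_nhds (Icc_mem_nhds hx.1 hx.2)

/-- **Monotonicity past the turning point.**  If `χ ≤ (2πλa)²`, `0 ≤ a`, and `f ≥ 0` on `[a, λ)`, then
`f′ ≤ 0` on `[a, λ)`: `(λ²−x²)f′(x) = −∫_x^λ((2πλt)² − χ)f(t)dt ≤ 0`. [folklore] -/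
theorem deriv_nonpos_of_nonneg (hf : IsProlateFunction lam n f) {χ : ℝ}
    (hχ : ∀ x ∈ Ioo (-lam) lam,
      -(deriv (fun y ↦ (lam ^ 2 - y ^ 2) * deriv f y) x) + (2 * π * lam * x) ^ 2 * f x = χ * f x)
    {a : ℝ} (ha : 0 ≤ a) (haχ : χ ≤ (2 * π * lam * a) ^ 2) (hpos : ∀ x ∈ Ico a lam, 0 ≤ f x)
    {y : ℝ} (hy : y ∈ Ico a lam) : deriv f y ≤ 0 := by
  have hlam := hf.lam_pos
  set F : ℝ → ℝ := fun z ↦ (lam ^ 2 - z ^ 2) * derivWithin f (Icc (-lam) lam) z with hFdef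
  have hFc : ContinuousOn F (Icc (-lam) lam) :=
    ((continuousOn_const).sub (continuousOn_id.pow 2)).mul hf.continuousOn_derivWithin
  have hFeq : ∀ z ∈ Ioo (-lam) lam, F z = (lam ^ 2 - z ^ 2) * deriv f z := fun z hz ↦ by
    simp only [hFdef]
    rw [hf.derivWithin_eq_deriv hz]
  have hy' : y ∈ Ioo (-lam) lam := ⟨by linarith [hy.1], hy.2⟩
  -- the integrand is nonnegative on `[a, λ)`
  have hk : ∀ t ∈ Ico a lam, 0 ≤ ((2 * π * lam * t) ^ 2 - χ) * f t := by
    intro t ht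
    refine mul_nonneg ?_ (hpos t ht)
    have h1 : 2 * π * lam * a ≤ 2 * π * lam * t := by
      have := Real.pi_pos; gcongr; exact ht.1
    have h2 : (2 * π * lam * a) ^ 2 ≤ (2 * π * lam * t) ^ 2 :=
      pow_le_pow_left₀ (by positivity) h1 2
    linarith
  -- `F y ≤ F z` for `z ∈ (y, λ)`
  have hmono : ∀ z ∈ Ioo y lam, F y ≤ F z := by
    intro z hz
    have hz' : z ∈ Ioo (-lam) lam := ⟨by linarith [hy.1, hz.1], hz.2⟩
    have hcont : ContinuousOn (fun t ↦ ((2 * π * lam * t) ^ 2 - χ) * f t) (Icc 0 lam) :=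
      (by fun_prop : Continuous fun t : ℝ ↦ (2 * π * lam * t) ^ 2 - χ).continuousOn.mul
        (hf.contDiffOn.continuousOn.mono (Icc_subset_Icc (by linarith) le_rfl))
    have hiy : IntervalIntegrable (fun t ↦ ((2 * π * lam * t) ^ 2 - χ) * f t) volume 0 y :=
      (hcont.mono (by rw [uIcc_of_le (ha.trans hy.1)]; exact Icc_subset_Icc le_rfl hy.2.le))
        |>.intervalIntegrable
    have hiz : IntervalIntegrable (fun t ↦ ((2 * π * lam * t) ^ 2 - χ) * f t) volume 0 z :=
      (hcont.mono (by rw [uIcc_of_le (by linarith [hz.1, hy.1])]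
                      exact Icc_subset_Icc le_rfl hz.2.le)).intervalIntegrable
    rw [hFeq y hy', hFeq z hz', hf.sqMulDeriv_eq_integral hχ ⟨ha.trans hy.1, hy.2⟩,
      hf.sqMulDeriv_eq_integral hχ ⟨by linarith [hz.1, hy.1], hz.2⟩, ← sub_nonneg,
      intervalIntegral.integral_interval_sub_left hiz hiy]
    exact intervalIntegral.integral_nonneg hz.1.le fun t ht ↦ hk t ⟨hy.1.trans ht.1, lt_of_le_of_lt ht.2 hz.2⟩
  -- `F z → F λ = 0` as `z → λ⁻`
  have hFlam : F lam = 0 := by simp [hFdef]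
  have htend : Tendsto F (𝓝[Ioo y lam] lam) (𝓝 0) := by
    rw [← hFlam]
    exact ((hFc lam (right_mem_Icc.2 (by linarith))).tendsto).mono_left
      (nhdsWithin_mono _ fun z hz ↦ ⟨by linarith [hz.1, hy.1], hz.2.le⟩)
  haveI : (𝓝[Ioo y lam] lam).NeBot := right_nhdsWithin_Ioo_neBot hy.2
  have hFy : F y ≤ 0 :=
    ge_of_tendsto htend (eventually_nhdsWithin_of_forall fun z hz ↦ hmono z hz)
  rw [hFeq y hy'] at hFy
  have hpos' : 0 < lam ^ 2 - y ^ 2 := by nlinarith [hy.1, hy.2]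
  by_contra h
  have := mul_pos hpos' (lt_of_not_ge h)
  linarith

/-- **Tail bound by monotonicity**: if `f′ ≤ 0` on `(a, λ)` (`0 ≤ a < λ`), then
`∫_a^λ|f′|(1+x)dx ≤ (1+a)f(a) + ∫_a^λ f + (1+λ)|f(λ)|` (integration by parts of `((1+x)f)′`).
[folklore] -/
theorem integral_abs_deriv_mul_le (hf : IsProlateFunction lam n f) {a : ℝ} (ha0 : 0 ≤ a)
    (hal : a < lam) (hd : ∀ x ∈ Ioo a lam, deriv f x ≤ 0) :
    (∫ x in a..lam, |deriv f x| * (1 + x))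
      ≤ (1 + a) * f a + (∫ x in a..lam, f x) + (1 + lam) * |f lam| := by
  have hlam := hf.lam_pos
  have hcf : ContinuousOn f (Icc a lam) :=
    hf.contDiffOn.continuousOn.mono (Icc_subset_Icc (by linarith) le_rfl)
  have hΦc : ContinuousOn (fun x ↦ (1 + x) * f x) (Icc a lam) :=
    (continuousOn_const.add continuousOn_id).mul hcf
  have hderiv : ∀ x ∈ Ioo a lam, HasDerivAt (fun x ↦ (1 + x) * f x) (f x + (1 + x) * deriv f x) x := by
    intro x hx
    have h1 : HasDerivAt (fun x : ℝ ↦ 1 + x) 1 x := (hasDerivAt_id x).const_add 1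
    have h2 := (hf.differentiableAt ⟨by linarith [hx.1], hx.2⟩).hasDerivAt
    exact (h1.mul h2).congr_deriv (by ring)
  have hsub : uIcc a lam ⊆ uIcc 0 lam := by
    rw [uIcc_of_le hal.le, uIcc_of_le hlam.le]; exact Icc_subset_Icc ha0 le_rfl
  have hfi : IntervalIntegrable f volume a lam :=
    (hcf.mono (by rw [uIcc_of_le hal.le])).intervalIntegrable
  have hdi : IntervalIntegrable (deriv f) volume a lam := hf.intervalIntegrable_deriv.mono_set hsub
  have hint : IntervalIntegrable (fun x ↦ f x + (1 + x) * deriv f x) volume a lam :=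
    hfi.add (hdi.continuousOn_mul (by fun_prop))
  have hFTC := intervalIntegral.integral_eq_sub_of_hasDerivAt_of_le hal.le hΦc hderiv hint
  have h1 : (∫ x in a..lam, |deriv f x| * (1 + x)) ≤ ∫ x in a..lam, -(deriv f x) * (1 + x) := by
    refine intervalIntegral.integral_mono_on_of_le_Ioo hal.le (hdi.abs.mul_continuousOn (by fun_prop))
      (hdi.neg.mul_continuousOn (by fun_prop)) fun x hx ↦ ?_
    rw [abs_of_nonpos (hd x hx)]
  have h2 : (∫ x in a..lam, -(deriv f x) * (1 + x))
      = (∫ x in a..lam, f x) - ((1 + lam) * f lam - (1 + a) * f a) := by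
    have : (fun x ↦ -(deriv f x) * (1 + x)) = fun x ↦ f x - (f x + (1 + x) * deriv f x) := by
      funext x; ring
    rw [this, intervalIntegral.integral_sub hfi hint, hFTC]
  have h3 : -((1 + lam) * f lam) ≤ (1 + lam) * |f lam| := by
    have := neg_abs_le (f lam)
    nlinarith
  linarith

/-- **Green's identity for the prolate and Hermite operators.**  For `f = h_{n,λ}` (eigenvalue `χ`)
and any `g` with `g″ = (4π²x² − μ)g`, `g′(0) = 0`:
`(χ − λ²μ)∫_0^λ f g = ∫_0^λ f·(2xg′ + x²(4π²x² − μ)g)` (`= ∫_0^λ f·(x²g′)′`; the weight `λ² − x²`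
kills the boundary term at `λ`, `f′(0) = g′(0) = 0` the one at `0`). [folklore] -/
theorem eigen_sub_mul_integral_eq (hf : IsProlateFunction lam n f) {χ : ℝ}
    (hχ : ∀ x ∈ Ioo (-lam) lam,
      -(deriv (fun y ↦ (lam ^ 2 - y ^ 2) * deriv f y) x) + (2 * π * lam * x) ^ 2 * f x = χ * f x)
    {g g' : ℝ → ℝ} {μ : ℝ} (hg : ∀ x, HasDerivAt g (g' x) x)
    (hg' : ∀ x, HasDerivAt g' ((4 * π ^ 2 * x ^ 2 - μ) * g x) x) (hg'0 : g' 0 = 0) :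
    (χ - lam ^ 2 * μ) * ∫ x in (0 : ℝ)..lam, f x * g x
      = ∫ x in (0 : ℝ)..lam, f x * (2 * x * g' x + x ^ 2 * ((4 * π ^ 2 * x ^ 2 - μ) * g x)) := by
  have hlam := hf.lam_pos
  have hgc : Continuous g := continuous_iff_continuousAt.2 fun x ↦ (hg x).continuousAt
  have hg'c : Continuous g' := continuous_iff_continuousAt.2 fun x ↦ (hg' x).continuousAt
  have hcf : ContinuousOn f (Icc 0 lam) :=
    hf.contDiffOn.continuousOn.mono (Icc_subset_Icc (by linarith) le_rfl)
  set W : ℝ → ℝ := fun z ↦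
    (lam ^ 2 - z ^ 2) * (derivWithin f (Icc (-lam) lam) z * g z - f z * g' z) with hWdef
  have hWc : ContinuousOn W (Icc 0 lam) :=
    ((continuousOn_const).sub (continuousOn_id.pow 2)).mul
      (((hf.continuousOn_derivWithin.mono (Icc_subset_Icc (by linarith) le_rfl)).mul
        hgc.continuousOn).sub (hcf.mul hg'c.continuousOn))
  -- the derivative of `W` on `(0, λ)`
  set w : ℝ → ℝ := fun z ↦ (lam ^ 2 * μ - χ) * (f z * g z)
    + f z * (2 * z * g' z + z ^ 2 * ((4 * π ^ 2 * z ^ 2 - μ) * g z)) with hwdef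
  have hWd : ∀ z ∈ Ioo 0 lam, HasDerivAt W (w z) z := by
    intro z hz
    have hz' : z ∈ Ioo (-lam) lam := ⟨by linarith [hz.1], hz.2⟩
    have hF := hf.hasDerivAt_sqMulDeriv hχ hz'
    have hf1 : HasDerivAt f (deriv f z) z := (hf.differentiableAt hz').hasDerivAt
    have hp : HasDerivAt (fun y : ℝ ↦ lam ^ 2 - y ^ 2) (-(2 * z)) z := by
      simpa using (hasDerivAt_pow 2 z).const_sub (lam ^ 2)
    have hK : HasDerivAt (fun y ↦ (lam ^ 2 - y ^ 2) * g' y)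
        (-(2 * z) * g' z + (lam ^ 2 - z ^ 2) * ((4 * π ^ 2 * z ^ 2 - μ) * g z)) z := hp.mul (hg' z)
    have hWt : HasDerivAt
        (fun y ↦ (lam ^ 2 - y ^ 2) * deriv f y * g y - f y * ((lam ^ 2 - y ^ 2) * g' y))
        (((2 * π * lam * z) ^ 2 - χ) * f z * g z + (lam ^ 2 - z ^ 2) * deriv f z * g' z
          - (deriv f z * ((lam ^ 2 - z ^ 2) * g' z)
            + f z * (-(2 * z) * g' z + (lam ^ 2 - z ^ 2) * ((4 * π ^ 2 * z ^ 2 - μ) * g z)))) z :=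
      (hF.mul (hg z)).sub (hf1.mul hK)
    have hEq : W =ᶠ[𝓝 z]
        (fun y ↦ (lam ^ 2 - y ^ 2) * deriv f y * g y - f y * ((lam ^ 2 - y ^ 2) * g' y)) := by
      filter_upwards [Ioo_mem_nhds hz'.1 hz'.2] with y hy
      simp only [hWdef]
      rw [hf.derivWithin_eq_deriv hy]
      ring
    refine (hWt.congr_of_eventuallyEq hEq).congr_deriv ?_
    simp only [hwdef]
    ring
  have hwc : ContinuousOn w (Icc 0 lam) := by
    simp only [hwdef]
    exact (continuousOn_const.mul (hcf.mul hgc.continuousOn)).add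
      (hcf.mul (by fun_prop : Continuous fun z : ℝ ↦
        2 * z * g' z + z ^ 2 * ((4 * π ^ 2 * z ^ 2 - μ) * g z)).continuousOn)
  have hwi : IntervalIntegrable w volume 0 lam :=
    (hwc.mono (by rw [uIcc_of_le hlam.le])).intervalIntegrable
  have hFTC := intervalIntegral.integral_eq_sub_of_hasDerivAt_of_le hlam.le hWc hWd hwi
  have hW0 : W 0 = 0 := by
    have : derivWithin f (Icc (-lam) lam) 0 = 0 := by
      rw [hf.derivWithin_eq_deriv ⟨by linarith, hlam⟩, hf.deriv_zero]
    simp [hWdef, this, hg'0]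
  have hWl : W lam = 0 := by simp [hWdef]
  rw [hW0, hWl, sub_zero] at hFTC
  -- split `∫ w`
  have i1 : IntervalIntegrable (fun z ↦ f z * g z) volume 0 lam :=
    ((hcf.mul hgc.continuousOn).mono (by rw [uIcc_of_le hlam.le])).intervalIntegrable
  have i2 : IntervalIntegrable
      (fun z ↦ f z * (2 * z * g' z + z ^ 2 * ((4 * π ^ 2 * z ^ 2 - μ) * g z))) volume 0 lam :=
    ((hcf.mul (by fun_prop : Continuous fun z : ℝ ↦
        2 * z * g' z + z ^ 2 * ((4 * π ^ 2 * z ^ 2 - μ) * g z)).continuousOn).mono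
      (by rw [uIcc_of_le hlam.le])).intervalIntegrable
  have hsplit : (∫ z in (0 : ℝ)..lam, w z)
      = (lam ^ 2 * μ - χ) * (∫ z in (0 : ℝ)..lam, f z * g z)
        + ∫ z in (0 : ℝ)..lam, f z * (2 * z * g' z + z ^ 2 * ((4 * π ^ 2 * z ^ 2 - μ) * g z)) := by
    simp only [hwdef]
    rw [intervalIntegral.integral_add (i1.const_mul _) i2, intervalIntegral.integral_const_mul]
  rw [hsplit] at hFTC
  linarith

/-- **Local derivative bound from the sup-norm distance.**  If `|f − g| ≤ δ` on `[−λ, λ]`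
(`f = h_{n,λ}` with eigenvalue `χ`, `g″ = (4π²x² − μ)g`, `g′(0) = 0`, `|g| ≤ G`), then for
`0 ≤ x ≤ X ≤ λ/2`: `|f′(x) − g′(x)| ≤ (4/(3λ²))·X·(((2πλX)² + |χ|)δ + (|λ²μ − χ| + X²(4π²X² + |μ|))G)`
(subtract the integrated equations `(λ²−x²)f′ = ∫_0^x((2πλt)²−χ)f`, `g′ = ∫_0^x(4π²t²−μ)g`). [folklore] -/
theorem abs_deriv_sub_le_of_supNorm (hf : IsProlateFunction lam n f) {χ : ℝ}
    (hχ : ∀ x ∈ Ioo (-lam) lam,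
      -(deriv (fun y ↦ (lam ^ 2 - y ^ 2) * deriv f y) x) + (2 * π * lam * x) ^ 2 * f x = χ * f x)
    {g g' : ℝ → ℝ} {μ : ℝ} (hg : ∀ x, HasDerivAt g (g' x) x)
    (hg' : ∀ x, HasDerivAt g' ((4 * π ^ 2 * x ^ 2 - μ) * g x) x) (hg'0 : g' 0 = 0)
    {G : ℝ} (hG : ∀ x, |g x| ≤ G) {δ : ℝ} (hδ : ∀ x ∈ Icc (-lam) lam, |f x - g x| ≤ δ)
    {X x : ℝ} (hX : 2 * X ≤ lam) (hx : x ∈ Icc 0 X) :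
    |deriv f x - g' x| ≤ 4 / (3 * lam ^ 2) * (X * (((2 * π * lam * X) ^ 2 + |χ|) * δ
        + (|lam ^ 2 * μ - χ| + X ^ 2 * (4 * π ^ 2 * X ^ 2 + |μ|)) * G)) := by
  have hlam := hf.lam_pos
  have hgc : Continuous g := continuous_iff_continuousAt.2 fun x ↦ (hg x).continuousAt
  obtain ⟨hx0, hxX⟩ := hx
  have hX0 : 0 ≤ X := hx0.trans hxX
  have hxl : x < lam := by linarith
  have hG0 : 0 ≤ G := (abs_nonneg _).trans (hG 0)
  have hδ0 : 0 ≤ δ := (abs_nonneg _).trans (hδ 0 ⟨by linarith, hlam.le⟩)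
  have e1 := hf.sqMulDeriv_eq_integral hχ ⟨hx0, hxl⟩
  have hkc : Continuous fun t : ℝ ↦ (4 * π ^ 2 * t ^ 2 - μ) * g t := by fun_prop
  have e2 : g' x = ∫ t in (0 : ℝ)..x, (4 * π ^ 2 * t ^ 2 - μ) * g t := by
    rw [intervalIntegral.integral_eq_sub_of_hasDerivAt (fun t _ ↦ hg' t)
      (hkc.intervalIntegrable _ _), hg'0, sub_zero]
  have hcf : ContinuousOn f (uIcc 0 x) := by
    rw [uIcc_of_le hx0]
    exact hf.contDiffOn.continuousOn.mono (Icc_subset_Icc (by linarith) hxl.le)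
  have i1 : IntervalIntegrable (fun t ↦ ((2 * π * lam * t) ^ 2 - χ) * f t) volume 0 x :=
    ((by fun_prop : Continuous fun t : ℝ ↦ (2 * π * lam * t) ^ 2 - χ).continuousOn.mul hcf)
      |>.intervalIntegrable
  have i2 : IntervalIntegrable (fun t ↦ (lam ^ 2 - x ^ 2) * ((4 * π ^ 2 * t ^ 2 - μ) * g t))
      volume 0 x := (hkc.intervalIntegrable _ _).const_mul _
  set m : ℝ → ℝ := fun t ↦ ((2 * π * lam * t) ^ 2 - χ) * (f t - g t)
    + ((lam ^ 2 * μ - χ) + x ^ 2 * (4 * π ^ 2 * t ^ 2 - μ)) * g t with hm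
  have e3 : (lam ^ 2 - x ^ 2) * (deriv f x - g' x) = ∫ t in (0 : ℝ)..x, m t := by
    rw [mul_sub, e1, e2, ← intervalIntegral.integral_const_mul, ← intervalIntegral.integral_sub i1 i2]
    refine intervalIntegral.integral_congr fun t _ ↦ ?_
    simp only [hm]
    ring
  -- pointwise bound of `m` on `(0, x]`
  set M : ℝ := ((2 * π * lam * X) ^ 2 + |χ|) * δ
    + (|lam ^ 2 * μ - χ| + X ^ 2 * (4 * π ^ 2 * X ^ 2 + |μ|)) * G with hM
  have hmb : ∀ t ∈ Set.uIoc 0 x, ‖m t‖ ≤ M := by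
    intro t ht
    rw [uIoc_of_le hx0] at ht
    have ht0 : 0 ≤ t := ht.1.le
    have htX : t ≤ X := ht.2.trans hxX
    have htl : t ∈ Icc (-lam) lam := ⟨by linarith, by linarith⟩
    have hsq : (2 * π * lam * t) ^ 2 ≤ (2 * π * lam * X) ^ 2 := by
      have := Real.pi_pos
      exact pow_le_pow_left₀ (by positivity) (by gcongr) 2
    have ht2 : t ^ 2 ≤ X ^ 2 := pow_le_pow_left₀ ht0 htX 2
    have hx2 : x ^ 2 ≤ X ^ 2 := pow_le_pow_left₀ hx0 hxX 2
    have b1 : |((2 * π * lam * t) ^ 2 - χ) * (f t - g t)| ≤ ((2 * π * lam * X) ^ 2 + |χ|) * δ := by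
      rw [abs_mul]
      refine mul_le_mul ((abs_sub _ _).trans ?_) (hδ t htl) (abs_nonneg _) (by positivity)
      rw [abs_of_nonneg (by positivity)]
      linarith
    have b2 : |((lam ^ 2 * μ - χ) + x ^ 2 * (4 * π ^ 2 * t ^ 2 - μ)) * g t|
        ≤ (|lam ^ 2 * μ - χ| + X ^ 2 * (4 * π ^ 2 * X ^ 2 + |μ|)) * G := by
      rw [abs_mul]
      refine mul_le_mul ((abs_add_le _ _).trans ?_) (hG t) (abs_nonneg _) (by positivity)
      have : |x ^ 2 * (4 * π ^ 2 * t ^ 2 - μ)| ≤ X ^ 2 * (4 * π ^ 2 * X ^ 2 + |μ|) := by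
        rw [abs_mul, abs_of_nonneg (sq_nonneg x)]
        refine mul_le_mul hx2 ((abs_sub _ _).trans ?_) (abs_nonneg _) (sq_nonneg X)
        rw [abs_of_nonneg (by positivity)]
        nlinarith [Real.pi_pos]
      linarith
    calc ‖m t‖ = |m t| := Real.norm_eq_abs _
      _ ≤ |((2 * π * lam * t) ^ 2 - χ) * (f t - g t)|
          + |((lam ^ 2 * μ - χ) + x ^ 2 * (4 * π ^ 2 * t ^ 2 - μ)) * g t| := abs_add_le _ _
      _ ≤ M := by rw [hM]; exact add_le_add b1 b2
  have hM0 : 0 ≤ M := by rw [hM]; positivity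
  have hint : ‖∫ t in (0 : ℝ)..x, m t‖ ≤ M * |x - 0| := intervalIntegral.norm_integral_le_of_norm_le_const hmb
  rw [sub_zero, abs_of_nonneg hx0, Real.norm_eq_abs, ← e3, abs_mul,
    abs_of_nonneg (by nlinarith : 0 ≤ lam ^ 2 - x ^ 2)] at hint
  have hpos : 0 < lam ^ 2 - x ^ 2 := by nlinarith
  have hkey : |deriv f x - g' x| ≤ X * M / (lam ^ 2 - x ^ 2) := by
    rw [le_div_iff₀ hpos]
    calc |deriv f x - g' x| * (lam ^ 2 - x ^ 2) = (lam ^ 2 - x ^ 2) * |deriv f x - g' x| := by ring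
      _ ≤ M * x := hint
      _ ≤ X * M := by nlinarith
  have h43 : 1 ≤ 4 / (3 * lam ^ 2) * (lam ^ 2 - x ^ 2) := by
    rw [div_mul_eq_mul_div, le_div_iff₀ (by positivity)]
    nlinarith
  calc |deriv f x - g' x| ≤ X * M / (lam ^ 2 - x ^ 2) := hkey
    _ ≤ X * M / (lam ^ 2 - x ^ 2) * (4 / (3 * lam ^ 2) * (lam ^ 2 - x ^ 2)) :=
        le_mul_of_one_le_right (by positivity) h43
    _ = 4 / (3 * lam ^ 2) * (X * M) := by field_simp
    _ = _ := by rw [hM]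

end IsProlateFunction

/-- **Eigenvalue asymptotics from the sup-norm asymptotics**: if `λ·max_{[−λ,λ]}|h_{n,λ} − g| → 0`
(indeed `max|h_{n,λ} − g| → 0` would do), where `g″ = (4π²x² − μ)g`, `g′(0) = 0`, `g` bounded and
integrable with `∫_0^∞ g² > 0` and `(x²g′)′ ∈ L¹`, then the prolate eigenvalue satisfies
`|χ_n(λ) − μλ²| ≤ D` for `λ` large (Green's identity `(χ − λ²μ)∫_0^λ fg = ∫_0^λ f(x²g′)′` with
`∫_0^λ fg ≥ ½∫_0^∞ g² − δ∫|g| > 0`).  For `g = h_n`, `μ = 2π(2n+1)`: `χ_n(λ) = 2π(2n+1)λ² + O(1)`.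
[cite: ConnesConsaniMoscovici2025, Lemma 7.2] -/
theorem eigen_sub_le_of_supLimit {n : ℕ} {g g' : ℝ → ℝ} {μ : ℝ} (hg : ∀ x, HasDerivAt g (g' x) x)
    (hg' : ∀ x, HasDerivAt g' ((4 * π ^ 2 * x ^ 2 - μ) * g x) x) (hg'0 : g' 0 = 0)
    {G : ℝ} (hG : ∀ x, |g x| ≤ G) (Ig : Integrable g)
    (IQ : IntegrableOn (fun x ↦ |2 * x * g' x + x ^ 2 * ((4 * π ^ 2 * x ^ 2 - μ) * g x)|) (Ioi 0))
    (hP : 0 < ∫ x in Ioi 0, g x ^ 2)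
    (hS : ∀ η : ℝ, 0 < η → ∃ Λ : ℝ, ∀ lam : ℝ, Λ ≤ lam → ∀ f : ℝ → ℝ,
      IsProlateFunction lam n f → ∀ x ∈ Icc (-lam) lam, lam * |f x - g x| ≤ η) :
    ∃ D Λ : ℝ, 0 ≤ D ∧ ∀ lam : ℝ, Λ ≤ lam → ∀ (f : ℝ → ℝ) (χ : ℝ), IsProlateFunction lam n f →
      (∀ x ∈ Ioo (-lam) lam, -(deriv (fun y ↦ (lam ^ 2 - y ^ 2) * deriv f y) x)
          + (2 * π * lam * x) ^ 2 * f x = χ * f x) → |χ - lam ^ 2 * μ| ≤ D := by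
  have hgc : Continuous g := continuous_iff_continuousAt.2 fun x ↦ (hg x).continuousAt
  have hg'c : Continuous g' := continuous_iff_continuousAt.2 fun x ↦ (hg' x).continuousAt
  have hG0 : 0 ≤ G := (abs_nonneg _).trans (hG 0)
  set q : ℝ → ℝ := fun x ↦ 2 * x * g' x + x ^ 2 * ((4 * π ^ 2 * x ^ 2 - μ) * g x) with hq
  have hqc : Continuous q := by simp only [hq]; fun_prop
  set P : ℝ := ∫ x in Ioi 0, g x ^ 2 with hPdef
  set Q : ℝ := ∫ x in Ioi 0, |q x| with hQdef
  set N : ℝ := ∫ x in Ioi 0, |g x| with hNdef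
  have hQ0 : 0 ≤ Q := setIntegral_nonneg measurableSet_Ioi fun x _ ↦ abs_nonneg _
  have hN0 : 0 ≤ N := setIntegral_nonneg measurableSet_Ioi fun x _ ↦ abs_nonneg _
  -- integrability of `g²` and the limit `∫_0^λ g² → P`
  have Ig2 : Integrable (fun x ↦ g x ^ 2) := by
    refine (Ig.abs.const_mul G).mono' (hgc.pow 2).aestronglyMeasurable (Eventually.of_forall fun x ↦ ?_)
    rw [Real.norm_eq_abs, abs_of_nonneg (sq_nonneg _), sq, ← abs_mul_abs_self]
    exact mul_le_mul_of_nonneg_right (hG x) (abs_nonneg _)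
  have tP : Tendsto (fun lam : ℝ ↦ ∫ x in (0 : ℝ)..lam, g x ^ 2) atTop (𝓝 P) :=
    intervalIntegral_tendsto_integral_Ioi 0 Ig2.integrableOn tendsto_id
  have e1 : ∀ᶠ lam : ℝ in atTop, P / 2 ≤ ∫ x in (0 : ℝ)..lam, g x ^ 2 :=
    (tP.eventually (Ioi_mem_nhds (by linarith : P / 2 < P))).mono fun lam h ↦ le_of_lt h
  -- the sup-norm tolerance `δ = min(1, P/(4(N+1)))`
  set δ : ℝ := min 1 (P / (4 * (N + 1))) with hδdef
  have hδpos : 0 < δ := lt_min one_pos (by positivity)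
  have hδ0 : 0 ≤ δ := hδpos.le
  have hδ1 : δ ≤ 1 := min_le_left _ _
  have hδN : δ * N ≤ P / 4 := by
    have h1 : δ * N ≤ P / (4 * (N + 1)) * N := mul_le_mul_of_nonneg_right (min_le_right _ _) hN0
    have h2 : P / (4 * (N + 1)) * N ≤ P / 4 := by
      rw [div_mul_eq_mul_div, div_le_div_iff₀ (by positivity) (by positivity)]
      nlinarith
    exact h1.trans h2
  obtain ⟨Λs, hΛS⟩ := hS δ hδpos
  obtain ⟨Λ, hΛ⟩ := Filter.eventually_atTop.1 (e1.and (eventually_ge_atTop (max Λs 1)))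
  refine ⟨4 * ((G + 1) * Q) / P, Λ, by positivity, fun lam hlam f χ hf hχ ↦ ?_⟩
  obtain ⟨hP2, hΛs1⟩ := hΛ lam hlam
  have hΛs : Λs ≤ lam := (le_max_left _ _).trans hΛs1
  have hlam1 : 1 ≤ lam := (le_max_right _ _).trans hΛs1
  have hlam0 := hf.lam_pos
  have hδ : ∀ x ∈ Icc (-lam) lam, |f x - g x| ≤ δ := by
    intro x hx
    have h := hΛS lam hΛs f hf x hx
    nlinarith [abs_nonneg (f x - g x)]
  have hcf : ContinuousOn f (Icc 0 lam) :=
    hf.contDiffOn.continuousOn.mono (Icc_subset_Icc (by linarith) le_rfl)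
  have hu : uIcc 0 lam = Icc 0 lam := uIcc_of_le hlam0.le
  have ifg : IntervalIntegrable (fun x ↦ f x * g x) volume 0 lam :=
    ((hcf.mul hgc.continuousOn).mono hu.le).intervalIntegrable
  have ifq : IntervalIntegrable (fun x ↦ f x * q x) volume 0 lam :=
    ((hcf.mul hqc.continuousOn).mono hu.le).intervalIntegrable
  -- Green's identity
  have hgreen := hf.eigen_sub_mul_integral_eq hχ hg hg' hg'0
  -- lower bound `∫_0^λ f g ≥ P/4`
  have hlow : P / 4 ≤ ∫ x in (0 : ℝ)..lam, f x * g x := by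
    have hpt : ∀ x ∈ Icc 0 lam, g x ^ 2 - δ * |g x| ≤ f x * g x := by
      intro x hx
      have h1 : |(f x - g x) * g x| ≤ δ * |g x| := by
        rw [abs_mul]; exact mul_le_mul_of_nonneg_right (hδ x ⟨by linarith [hx.1], hx.2⟩) (abs_nonneg _)
      have h2 := neg_abs_le ((f x - g x) * g x)
      nlinarith
    have ig2 : IntervalIntegrable (fun x ↦ g x ^ 2) volume 0 lam := (hgc.pow 2).intervalIntegrable _ _
    have igd : IntervalIntegrable (fun x ↦ δ * |g x|) volume 0 lam :=
      (continuous_const.mul hgc.abs).intervalIntegrable _ _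
    have hmono := intervalIntegral.integral_mono_on hlam0.le (ig2.sub igd) ifg hpt
    rw [intervalIntegral.integral_sub ig2 igd, intervalIntegral.integral_const_mul] at hmono
    have hN : (∫ x in (0 : ℝ)..lam, |g x|) ≤ N := by
      rw [intervalIntegral.integral_of_le hlam0.le]
      exact setIntegral_mono_set Ig.abs.integrableOn
        (Eventually.of_forall fun x ↦ abs_nonneg _) (Eventually.of_forall Ioc_subset_Ioi_self)
    nlinarith
  -- upper bound `|∫_0^λ f q| ≤ (G+1) Q`
  have hup : |∫ x in (0 : ℝ)..lam, f x * q x| ≤ (G + 1) * Q := by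
    have hpt : ∀ x ∈ Icc 0 lam, |f x * q x| ≤ (G + 1) * |q x| := by
      intro x hx
      rw [abs_mul]
      refine mul_le_mul_of_nonneg_right ?_ (abs_nonneg _)
      have := hδ x ⟨by linarith [hx.1], hx.2⟩
      have := hG x
      have := abs_sub_abs_le_abs_sub (f x) (g x)
      linarith
    calc |∫ x in (0 : ℝ)..lam, f x * q x| ≤ ∫ x in (0 : ℝ)..lam, |f x * q x| :=
          intervalIntegral.abs_integral_le_integral_abs hlam0.le
      _ ≤ ∫ x in (0 : ℝ)..lam, (G + 1) * |q x| :=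
          intervalIntegral.integral_mono_on hlam0.le ifq.abs
            ((continuous_const.mul hqc.abs).intervalIntegrable _ _) hpt
      _ = (G + 1) * ∫ x in (0 : ℝ)..lam, |q x| := intervalIntegral.integral_const_mul _ _
      _ ≤ (G + 1) * Q := by
          refine mul_le_mul_of_nonneg_left ?_ (by positivity)
          rw [intervalIntegral.integral_of_le hlam0.le]
          exact setIntegral_mono_set IQ (Eventually.of_forall fun x ↦ abs_nonneg _)
            (Eventually.of_forall Ioc_subset_Ioi_self)
  -- conclude
  have hfg0 : 0 < ∫ x in (0 : ℝ)..lam, f x * g x := lt_of_lt_of_le (by positivity) hlow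
  have key : |χ - lam ^ 2 * μ| * (P / 4) ≤ (G + 1) * Q := by
    calc |χ - lam ^ 2 * μ| * (P / 4) ≤ |χ - lam ^ 2 * μ| * ∫ x in (0 : ℝ)..lam, f x * g x :=
          mul_le_mul_of_nonneg_left hlow (abs_nonneg _)
      _ = |(χ - lam ^ 2 * μ) * ∫ x in (0 : ℝ)..lam, f x * g x| := by
          rw [abs_mul, abs_of_pos hfg0]
      _ = |∫ x in (0 : ℝ)..lam, f x * q x| := by rw [hgreen]
      _ ≤ (G + 1) * Q := hup
  rw [le_div_iff₀ hP]
  linarith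

set_option maxHeartbeats 800000 in
/-- **(S) + zero-free tail ⇒ (W).**  Let `g` satisfy `g″ = (4π²x² − μ)g`, `g′(0) = 0`, with
`g` bounded and integrable, `(1+x)g′` and `(x²g′)′` integrable on `(0,∞)`, `∫_0^∞ g² > 0`,
`x g(x) → 0`.  If `λ·max_{[−λ,λ]}|h_{n,λ} − g| → 0` (hypothesis (Sₙ) of
`prolateGuess_tendsto_riemannXi_of_hermiteLimit`; implied by CCM25 Lemma 7.2(i) when `g = h_n`)
and `h_{n,λ} ≥ 0` on `[X₀, λ)` for `λ` large, then `∫_0^λ|h_{n,λ}′ − g′|(1+x)dx → 0` —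
hypothesis (Wₙ) of `prolateGuess_tendsto_riemannXi_of_hermiteLimit`: on `[0, X]` the derivative
bound is `K₁·(λ max|h_{n,λ} − g|) + K₂λ^{-2}`, on `[X, λ)` monotonicity gives a Gaussian tail plus
`(4+X)·λ max|h_{n,λ} − g|`. [cite: ConnesConsaniMoscovici2025, Lemma 7.3] -/
theorem integral_abs_deriv_sub_le_of_supLimit {n : ℕ} {g g' : ℝ → ℝ} {μ : ℝ}
    (hg : ∀ x, HasDerivAt g (g' x) x) (hg' : ∀ x, HasDerivAt g' ((4 * π ^ 2 * x ^ 2 - μ) * g x) x)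
    (hg'0 : g' 0 = 0) {G : ℝ} (hG : ∀ x, |g x| ≤ G) (Ig : Integrable g)
    (Ig' : IntegrableOn (fun x ↦ |g' x| * (1 + x)) (Ioi 0))
    (IQ : IntegrableOn (fun x ↦ |2 * x * g' x + x ^ 2 * ((4 * π ^ 2 * x ^ 2 - μ) * g x)|) (Ioi 0))
    (hP : 0 < ∫ x in Ioi 0, g x ^ 2) (hdec : Tendsto (fun x ↦ x * g x) atTop (𝓝 0))
    (hS : ∀ η : ℝ, 0 < η → ∃ Λ : ℝ, ∀ lam : ℝ, Λ ≤ lam → ∀ f : ℝ → ℝ,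
      IsProlateFunction lam n f → ∀ x ∈ Icc (-lam) lam, lam * |f x - g x| ≤ η)
    {X₀ Λ₀ : ℝ} (hX₀ : 0 ≤ X₀) (hZ : ∀ lam : ℝ, Λ₀ ≤ lam → ∀ f : ℝ → ℝ,
      IsProlateFunction lam n f → ∀ x ∈ Ico X₀ lam, 0 ≤ f x)
    (ε : ℝ) (hε : 0 < ε) :
    ∃ Λ : ℝ, ∀ lam : ℝ, Λ ≤ lam → ∀ f : ℝ → ℝ, IsProlateFunction lam n f →
      (∫ x in (0 : ℝ)..lam, |deriv f x - g' x| * (1 + x)) ≤ ε := by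
  have hgc : Continuous g := continuous_iff_continuousAt.2 fun x ↦ (hg x).continuousAt
  have hg'c : Continuous g' := continuous_iff_continuousAt.2 fun x ↦ (hg' x).continuousAt
  have hG0 : 0 ≤ G := (abs_nonneg _).trans (hG 0)
  obtain ⟨D, ΛD, hD0, hD⟩ := eigen_sub_le_of_supLimit hg hg' hg'0 hG Ig IQ hP hS
  -- limits in `X`
  have tg : Tendsto g atTop (𝓝 0) := by
    have h := hdec.mul tendsto_inv_atTop_zero
    rw [zero_mul] at h
    refine h.congr' ?_
    filter_upwards [eventually_gt_atTop 0] with x hx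
    rw [mul_comm, ← mul_assoc, inv_mul_cancel₀ hx.ne', one_mul]
  have t1 : Tendsto (fun X : ℝ ↦ (1 + X) * |g X|) atTop (𝓝 0) := by
    have h : Tendsto (fun X : ℝ ↦ g X + X * g X) atTop (𝓝 0) := by
      simpa using tg.add hdec
    have h' : Tendsto (fun X : ℝ ↦ |g X + X * g X|) atTop (𝓝 0) := by simpa using h.abs
    refine h'.congr' ?_
    filter_upwards [eventually_ge_atTop 0] with X hX
    rw [show g X + X * g X = (1 + X) * g X by ring, abs_mul, abs_of_nonneg (by linarith)]
  have t2 : Tendsto (fun X : ℝ ↦ ∫ x in Ioi X, |g x|) atTop (𝓝 0) :=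
    tendsto_setIntegral_Ioi_atTop_zero Ig.abs.integrableOn
  have t3 : Tendsto (fun X : ℝ ↦ ∫ x in Ioi X, |g' x| * (1 + x)) atTop (𝓝 0) :=
    tendsto_setIntegral_Ioi_atTop_zero Ig'
  have t4 : ∀ᶠ X : ℝ in atTop, |μ| + D ≤ (2 * π * X) ^ 2 := by
    have h : Tendsto (fun X : ℝ ↦ (2 * π * X) ^ 2) atTop atTop :=
      (tendsto_pow_atTop two_ne_zero).comp (tendsto_id.const_mul_atTop (by positivity))
    exact h.eventually_ge_atTop _
  have hε8 : 0 < ε / 8 := by positivity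
  obtain ⟨X, hX1, hXμ, hX2, hX3, hX4⟩ := ((eventually_ge_atTop (max X₀ 1)).and (t4.and
    ((t1.eventually (Iio_mem_nhds hε8)).and ((t2.eventually (Iio_mem_nhds hε8)).and
      (t3.eventually (Iio_mem_nhds hε8)))))).exists
  have hXX₀ : X₀ ≤ X := (le_max_left _ _).trans hX1
  have hX1' : 1 ≤ X := (le_max_right _ _).trans hX1
  have hX0 : 0 ≤ X := zero_le_one.trans hX1'
  have hX2' : (1 + X) * |g X| < ε / 8 := hX2
  have hX3' : (∫ x in Ioi X, |g x|) < ε / 8 := hX3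
  have hX4' : (∫ x in Ioi X, |g' x| * (1 + x)) < ε / 8 := hX4
  -- the constants of the local bound and the sup-norm tolerance `η`
  set K₁ : ℝ := 4 * X / 3 * (4 * π ^ 2 * X ^ 2 + |μ| + D) with hK₁
  set K₂ : ℝ := 4 * X / 3 * ((D + X ^ 2 * (4 * π ^ 2 * X ^ 2 + |μ|)) * G) with hK₂
  have hK₁0 : 0 ≤ K₁ := by positivity
  have hK₂0 : 0 ≤ K₂ := by positivity
  have hXK : 0 ≤ X * (1 + X) * K₁ := by positivity
  obtain ⟨M, hM0, hM1, hM2⟩ : ∃ M : ℝ, 0 < M ∧ X * (1 + X) * K₁ ≤ M ∧ 4 + X ≤ M :=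
    ⟨X * (1 + X) * K₁ + (4 + X) + 1, by positivity, by linarith, by linarith⟩
  obtain ⟨η, hη, hη1, hη2⟩ : ∃ η : ℝ, 0 < η ∧ X * (1 + X) * K₁ * η ≤ ε / 8 ∧ η * (4 + X) ≤ ε / 8 := by
    refine ⟨ε / (8 * M), by positivity, ?_, ?_⟩
    · calc X * (1 + X) * K₁ * (ε / (8 * M)) ≤ M * (ε / (8 * M)) :=
            mul_le_mul_of_nonneg_right hM1 (by positivity)
        _ = ε / 8 := by field_simp [hM0.ne']
    · calc ε / (8 * M) * (4 + X) ≤ ε / (8 * M) * M := mul_le_mul_of_nonneg_left hM2 (by positivity)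
        _ = ε / 8 := by field_simp [hM0.ne']
  obtain ⟨Λs, hΛS⟩ := hS η hη
  -- limits in `λ`
  have l2 : ∀ᶠ lam : ℝ in atTop, X * (1 + X) * K₂ / lam ^ 2 < ε / 8 := by
    have h : Tendsto (fun lam : ℝ ↦ X * (1 + X) * K₂ / lam ^ 2) atTop (𝓝 0) :=
      tendsto_const_nhds.div_atTop (tendsto_pow_atTop two_ne_zero)
    exact h.eventually (Iio_mem_nhds hε8)
  have l4 : ∀ᶠ lam : ℝ in atTop, (1 + lam) * |g lam| < ε / 8 := t1.eventually (Iio_mem_nhds hε8)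
  obtain ⟨Λ, hΛ⟩ := Filter.eventually_atTop.1
    ((eventually_ge_atTop (max (max ΛD Λs) (max Λ₀ (2 * X)))).and (l2.and l4))
  refine ⟨Λ, fun lam hlam f hf ↦ ?_⟩
  obtain ⟨hbig, hl2, hl4⟩ := hΛ lam hlam
  have hl2' : X * (1 + X) * K₂ / lam ^ 2 < ε / 8 := hl2
  have hl4' : (1 + lam) * |g lam| < ε / 8 := hl4
  have hΛD : ΛD ≤ lam := le_trans (le_trans (le_max_left _ _) (le_max_left _ _)) hbig
  have hΛs : Λs ≤ lam := le_trans (le_trans (le_max_right _ _) (le_max_left _ _)) hbig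
  have hΛ₀ : Λ₀ ≤ lam := le_trans (le_trans (le_max_left _ _) (le_max_right _ _)) hbig
  have h2X : 2 * X ≤ lam := le_trans (le_trans (le_max_right _ _) (le_max_right _ _)) hbig
  have hlam0 : 0 < lam := hf.lam_pos
  have hlam1 : 1 ≤ lam := by linarith
  have hXl : X < lam := by linarith
  obtain ⟨χ, hχ⟩ := hf.eigen
  have hDχ : |χ - lam ^ 2 * μ| ≤ D := hD lam hΛD f χ hf hχ
  set δ : ℝ := η / lam with hδdef
  have hδ0 : 0 ≤ δ := by positivity
  have hδ : ∀ x ∈ Icc (-lam) lam, |f x - g x| ≤ δ := by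
    intro x hx
    rw [hδdef, le_div_iff₀ hlam0, mul_comm]
    exact hΛS lam hΛs f hf x hx
  have hδη : δ ≤ η := by
    rw [hδdef, div_le_iff₀ hlam0]
    have := mul_le_mul_of_nonneg_left hlam1 hη.le
    linarith
  have hχabs : |χ| ≤ D + lam ^ 2 * |μ| := by
    have := abs_sub_abs_le_abs_sub χ (lam ^ 2 * μ)
    rw [abs_mul, abs_of_nonneg (sq_nonneg lam)] at this
    linarith
  have hlsq : 1 ≤ lam ^ 2 := by nlinarith
  have hχl : |χ| ≤ lam ^ 2 * (|μ| + D) := by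
    nlinarith [hχabs, mul_nonneg hD0 (sub_nonneg.2 hlsq)]
  -- integrability of the integrand on `[0, λ]`
  have hI : IntervalIntegrable (fun x ↦ |deriv f x - g' x| * (1 + x)) volume 0 lam :=
    (hf.intervalIntegrable_deriv.sub (hg'c.intervalIntegrable _ _)).abs.mul_continuousOn
      (by fun_prop)
  have hI1 : IntervalIntegrable (fun x ↦ |deriv f x - g' x| * (1 + x)) volume 0 X :=
    hI.mono_set (by rw [uIcc_of_le hX0, uIcc_of_le hlam0.le]; exact Icc_subset_Icc le_rfl hXl.le)
  have hI2 : IntervalIntegrable (fun x ↦ |deriv f x - g' x| * (1 + x)) volume X lam :=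
    hI.mono_set (by rw [uIcc_of_le hXl.le, uIcc_of_le hlam0.le]; exact Icc_subset_Icc hX0 le_rfl)
  -- (A) the compact part `[0, X]`
  have hA : (∫ x in (0 : ℝ)..X, |deriv f x - g' x| * (1 + x)) ≤ ε / 4 := by
    have hpt : ∀ x ∈ Icc 0 X, |deriv f x - g' x| * (1 + x)
        ≤ (K₁ * η + K₂ / lam ^ 2) * (1 + X) := by
      intro x hx
      have hb := hf.abs_deriv_sub_le_of_supNorm hχ hg hg' hg'0 hG hδ h2X hx
      have s1 : ((2 * π * lam * X) ^ 2 + |χ|) * δ ≤ lam ^ 2 * (4 * π ^ 2 * X ^ 2 + |μ| + D) * η := by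
        have e : (2 * π * lam * X) ^ 2 + |χ| ≤ lam ^ 2 * (4 * π ^ 2 * X ^ 2 + |μ| + D) := by
          have : (2 * π * lam * X) ^ 2 = lam ^ 2 * (4 * π ^ 2 * X ^ 2) := by ring
          rw [this]
          linarith [hχl]
        calc ((2 * π * lam * X) ^ 2 + |χ|) * δ ≤ lam ^ 2 * (4 * π ^ 2 * X ^ 2 + |μ| + D) * δ :=
              mul_le_mul_of_nonneg_right e hδ0
          _ ≤ lam ^ 2 * (4 * π ^ 2 * X ^ 2 + |μ| + D) * η :=
              mul_le_mul_of_nonneg_left hδη (by positivity)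
      have s2 : (|lam ^ 2 * μ - χ| + X ^ 2 * (4 * π ^ 2 * X ^ 2 + |μ|)) * G
          ≤ (D + X ^ 2 * (4 * π ^ 2 * X ^ 2 + |μ|)) * G := by
        have : |lam ^ 2 * μ - χ| ≤ D := by rw [abs_sub_comm]; exact hDχ
        exact mul_le_mul_of_nonneg_right (by linarith) hG0
      have hb' : |deriv f x - g' x| ≤ K₁ * η + K₂ / lam ^ 2 := by
        refine hb.trans ?_
        calc 4 / (3 * lam ^ 2) * (X * (((2 * π * lam * X) ^ 2 + |χ|) * δ
              + (|lam ^ 2 * μ - χ| + X ^ 2 * (4 * π ^ 2 * X ^ 2 + |μ|)) * G))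
            ≤ 4 / (3 * lam ^ 2) * (X * (lam ^ 2 * (4 * π ^ 2 * X ^ 2 + |μ| + D) * η
              + (D + X ^ 2 * (4 * π ^ 2 * X ^ 2 + |μ|)) * G)) :=
              mul_le_mul_of_nonneg_left (mul_le_mul_of_nonneg_left (add_le_add s1 s2) hX0)
                (by positivity)
          _ = K₁ * η + K₂ / lam ^ 2 := by rw [hK₁, hK₂]; field_simp
      exact mul_le_mul hb' (by linarith [hx.2]) (by linarith [hx.1]) (by positivity)
    calc (∫ x in (0 : ℝ)..X, |deriv f x - g' x| * (1 + x))
        ≤ ∫ x in (0 : ℝ)..X, (K₁ * η + K₂ / lam ^ 2) * (1 + X) :=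
          intervalIntegral.integral_mono_on hX0 hI1 intervalIntegrable_const hpt
      _ = X * (1 + X) * K₁ * η + X * (1 + X) * K₂ / lam ^ 2 := by
          rw [intervalIntegral.integral_const, smul_eq_mul]; ring
      _ ≤ ε / 4 := by linarith [hη1, hl2'.le]
  -- (B) the tail `[X, λ]`
  have hB : (∫ x in X..lam, |deriv f x - g' x| * (1 + x)) ≤ 5 * ε / 8 := by
    have hposf : ∀ x ∈ Ico X lam, 0 ≤ f x := fun x hx ↦ hZ lam hΛ₀ f hf x ⟨hXX₀.trans hx.1, hx.2⟩
    have hχX : χ ≤ (2 * π * lam * X) ^ 2 := by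
      have h1 : χ ≤ |χ| := le_abs_self χ
      have h2 : (2 * π * lam * X) ^ 2 = lam ^ 2 * (2 * π * X) ^ 2 := by ring
      have h3 : lam ^ 2 * (|μ| + D) ≤ lam ^ 2 * (2 * π * X) ^ 2 :=
        mul_le_mul_of_nonneg_left hXμ (sq_nonneg lam)
      rw [h2]
      linarith [hχl]
    have hd : ∀ x ∈ Ioo X lam, deriv f x ≤ 0 := fun x hx ↦
      hf.deriv_nonpos_of_nonneg hχ hX0 hχX hposf ⟨hx.1.le, hx.2⟩
    have tailf := hf.integral_abs_deriv_mul_le hX0 hXl hd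
    have hcf : ContinuousOn f (Icc X lam) :=
      hf.contDiffOn.continuousOn.mono (Icc_subset_Icc (by linarith) le_rfl)
    have hfX : f X ≤ |g X| + δ := by
      have := hδ X ⟨by linarith, hXl.le⟩
      have := le_abs_self (g X)
      have := abs_sub_abs_le_abs_sub (f X) (g X)
      linarith [le_abs_self (f X)]
    have hfl : |f lam| ≤ |g lam| + δ := by
      have := hδ lam ⟨by linarith, le_rfl⟩
      have := abs_sub_abs_le_abs_sub (f lam) (g lam)
      linarith
    have hIf : (∫ x in X..lam, f x) ≤ (∫ x in Ioi X, |g x|) + lam * δ := by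
      have i1 : IntervalIntegrable f volume X lam := (hcf.mono (by rw [uIcc_of_le hXl.le])).intervalIntegrable
      have i2 : IntervalIntegrable (fun x ↦ |g x| + δ) volume X lam :=
        (hgc.abs.add continuous_const).intervalIntegrable _ _
      have hpt : ∀ x ∈ Icc X lam, f x ≤ |g x| + δ := by
        intro x hx
        have := hδ x ⟨by linarith [hx.1], hx.2⟩
        have := abs_sub_abs_le_abs_sub (f x) (g x)
        linarith [le_abs_self (f x)]
      have hm := intervalIntegral.integral_mono_on hXl.le i1 i2 hpt
      have iga : IntervalIntegrable (fun x ↦ |g x|) volume X lam := hgc.abs.intervalIntegrable _ _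
      have iδ : IntervalIntegrable (fun _ : ℝ ↦ δ) volume X lam := intervalIntegrable_const
      rw [intervalIntegral.integral_add iga iδ] at hm
      simp only [intervalIntegral.integral_const, smul_eq_mul] at hm
      have hN : (∫ x in X..lam, |g x|) ≤ ∫ x in Ioi X, |g x| := by
        rw [intervalIntegral.integral_of_le hXl.le]
        exact setIntegral_mono_set (Ig.abs.integrableOn)
          (Eventually.of_forall fun x ↦ abs_nonneg _) (Eventually.of_forall Ioc_subset_Ioi_self)
      have hXδ : (lam - X) * δ ≤ lam * δ := by nlinarith [mul_nonneg hX0 hδ0]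
      linarith
    have hIg' : (∫ x in X..lam, |g' x| * (1 + x)) ≤ ∫ x in Ioi X, |g' x| * (1 + x) := by
      rw [intervalIntegral.integral_of_le hXl.le]
      refine setIntegral_mono_set (Ig'.mono_set (Ioi_subset_Ioi hX0)) ?_
        (Eventually.of_forall Ioc_subset_Ioi_self)
      filter_upwards [ae_restrict_mem measurableSet_Ioi] with x hx
      exact mul_nonneg (abs_nonneg _) (by linarith [mem_Ioi.1 hx])
    have hdi : IntervalIntegrable (deriv f) volume X lam :=
      hf.intervalIntegrable_deriv.mono_set
        (by rw [uIcc_of_le hXl.le, uIcc_of_le hlam0.le]; exact Icc_subset_Icc hX0 le_rfl)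
    have j1 : IntervalIntegrable (fun x ↦ |deriv f x| * (1 + x)) volume X lam :=
      hdi.abs.mul_continuousOn (by fun_prop)
    have j2 : IntervalIntegrable (fun x ↦ |g' x| * (1 + x)) volume X lam :=
      (by fun_prop : Continuous fun x : ℝ ↦ |g' x| * (1 + x)).intervalIntegrable _ _
    have hsplit : (∫ x in X..lam, |deriv f x - g' x| * (1 + x))
        ≤ (∫ x in X..lam, |deriv f x| * (1 + x)) + ∫ x in X..lam, |g' x| * (1 + x) := by
      rw [← intervalIntegral.integral_add j1 j2]
      refine intervalIntegral.integral_mono_on hXl.le hI2 (j1.add j2) fun x hx ↦ ?_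
      rw [← add_mul]
      exact mul_le_mul_of_nonneg_right (abs_sub _ _) (by linarith [hx.1])
    have hδsum : δ * ((1 + X) + lam + (1 + lam)) ≤ ε / 8 := by
      have e1 : δ * ((1 + X) + lam + (1 + lam)) = δ * (2 + X) + 2 * (δ * lam) := by ring
      have e2 : δ * lam = η := by rw [hδdef]; field_simp
      rw [e1, e2]
      have : δ * (2 + X) ≤ η * (2 + X) := mul_le_mul_of_nonneg_right hδη (by linarith)
      linarith [hη2]
    have h1X : 0 ≤ 1 + X := by linarith
    have h1l : 0 ≤ 1 + lam := by linarith
    calc (∫ x in X..lam, |deriv f x - g' x| * (1 + x))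
        ≤ (∫ x in X..lam, |deriv f x| * (1 + x)) + ∫ x in X..lam, |g' x| * (1 + x) := hsplit
      _ ≤ ((1 + X) * f X + (∫ x in X..lam, f x) + (1 + lam) * |f lam|)
          + ∫ x in Ioi X, |g' x| * (1 + x) := add_le_add tailf hIg'
      _ ≤ ((1 + X) * (|g X| + δ) + ((∫ x in Ioi X, |g x|) + lam * δ) + (1 + lam) * (|g lam| + δ))
          + ∫ x in Ioi X, |g' x| * (1 + x) :=
          add_le_add (add_le_add (add_le_add (mul_le_mul_of_nonneg_left hfX h1X) hIf)
            (mul_le_mul_of_nonneg_left hfl h1l)) le_rfl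
      _ = (1 + X) * |g X| + (∫ x in Ioi X, |g x|) + (1 + lam) * |g lam|
          + (∫ x in Ioi X, |g' x| * (1 + x)) + δ * ((1 + X) + lam + (1 + lam)) := by ring
      _ ≤ 5 * ε / 8 := by linarith
  -- (C) assemble
  rw [← intervalIntegral.integral_add_adjacent_intervals hI1 hI2]
  linarith

/-! ### The Hermite data `h_0`, `h_4`: second derivatives, bounds, integrability -/

/-- `y e^{−y} ≤ 1` and `y² e^{−y} ≤ 2` for `y ≥ 0`. [folklore] -/
theorem mul_exp_neg_le {y : ℝ} (hy : 0 ≤ y) : y * Real.exp (-y) ≤ 1 ∧ y ^ 2 * Real.exp (-y) ≤ 2 := by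
  have h1 := Real.add_one_le_exp y
  have h2 := Real.quadratic_le_exp_of_nonneg hy
  have he : Real.exp (-y) = (Real.exp y)⁻¹ := Real.exp_neg y
  have hpos := Real.exp_pos y
  rw [he]
  constructor
  · rw [mul_inv_le_iff₀ hpos]; linarith
  · rw [mul_inv_le_iff₀ hpos]; nlinarith

/-- `h_0″ = (4π²x² − 2π)h_0` (`−h_0″ + 4π²x²h_0 = 2π h_0`). [folklore] -/
theorem hasDerivAt_hermiteH0' (x : ℝ) :
    HasDerivAt hermiteH0' ((4 * π ^ 2 * x ^ 2 - 2 * π) * hermiteH0 x) x := by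
  have a := (((hasDerivAt_id' x).const_mul (2 * π)).neg).mul
    ((((hasDerivAt_pow 2 x).const_mul (-π)).exp).const_mul ((2 : ℝ) ^ ((1 : ℝ) / 4)))
  have hfun : hermiteH0' = fun y : ℝ ↦ -(2 * π * y) * ((2 : ℝ) ^ ((1 : ℝ) / 4) * Real.exp (-π * y ^ 2)) :=
    rfl
  rw [hfun]
  refine a.congr_deriv ?_
  simp only [hermiteH0, Pi.neg_apply]
  push_cast
  ring

/-- `h_4″ = (4π²x² − 18π)h_4` (`−h_4″ + 4π²x²h_4 = 18π h_4`). [folklore] -/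
theorem hasDerivAt_hermiteH4' (x : ℝ) :
    HasDerivAt hermiteH4' ((4 * π ^ 2 * x ^ 2 - 18 * π) * hermiteH4 x) x := by
  have a := (((((hasDerivAt_pow 5 x).const_mul (-32 * π ^ 3)).fun_add
    ((hasDerivAt_pow 3 x).const_mul (112 * π ^ 2))).fun_sub
      ((hasDerivAt_id' x).const_mul (54 * π))).fun_mul
        (((hasDerivAt_pow 2 x).const_mul (-π)).exp)).div_const (16 * prolateGuessA)
  have hfun : hermiteH4' = fun y : ℝ ↦
      (-32 * π ^ 3 * y ^ 5 + 112 * π ^ 2 * y ^ 3 - 54 * π * y) * Real.exp (-π * y ^ 2)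
        / (16 * prolateGuessA) := rfl
  rw [hfun]
  refine a.congr_deriv ?_
  simp only [hermiteH4]
  push_cast
  ring

/-- `h_0′(0) = 0`. [folklore] -/
theorem hermiteH0'_zero : hermiteH0' 0 = 0 := by simp [hermiteH0']

/-- `h_4′(0) = 0`. [folklore] -/
theorem hermiteH4'_zero : hermiteH4' 0 = 0 := by simp [hermiteH4']

/-- `|h_0| ≤ 2^{1/4}`. [folklore] -/
theorem abs_hermiteH0_le (x : ℝ) : |hermiteH0 x| ≤ (2 : ℝ) ^ ((1 : ℝ) / 4) := by
  rw [abs_of_pos (hermiteH0_pos x)]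
  unfold hermiteH0
  have h2 : 0 ≤ (2 : ℝ) ^ ((1 : ℝ) / 4) := (Real.rpow_pos_of_pos two_pos _).le
  have he : Real.exp (-π * x ^ 2) ≤ 1 := Real.exp_le_one_iff.2 (by nlinarith [Real.pi_pos, sq_nonneg x])
  nlinarith

/-- `|h_4| ≤ 59/(16A)` (`(πx²)^k e^{−πx²} ≤ k!`). [folklore] -/
theorem abs_hermiteH4_le (x : ℝ) : |hermiteH4 x| ≤ 59 / (16 * prolateGuessA) := by
  have hA := prolateGuessA_pos
  obtain ⟨h1, h2⟩ := mul_exp_neg_le (by positivity : 0 ≤ π * x ^ 2)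
  have he0 : Real.exp (-(π * x ^ 2)) ≤ 1 := Real.exp_le_one_iff.2 (by nlinarith [Real.pi_pos, sq_nonneg x])
  have hee : Real.exp (-π * x ^ 2) = Real.exp (-(π * x ^ 2)) := by ring_nf
  unfold hermiteH4
  rw [abs_div, abs_of_pos (by positivity : (0 : ℝ) < 16 * prolateGuessA), div_le_div_iff_of_pos_right
    (by positivity), abs_mul, abs_of_pos (Real.exp_pos _), hee]
  have hP : |16 * π ^ 2 * x ^ 4 - 24 * π * x ^ 2 + 3| ≤ 16 * (π * x ^ 2) ^ 2 + 24 * (π * x ^ 2) + 3 := by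
    refine (abs_add_le _ _).trans ?_
    rw [abs_of_pos (by norm_num : (0 : ℝ) < 3)]
    refine add_le_add ((abs_sub _ _).trans (le_of_eq ?_)) le_rfl
    rw [abs_of_nonneg (by positivity), abs_of_nonneg (by positivity)]
    ring
  have hepos := Real.exp_pos (-(π * x ^ 2))
  calc |16 * π ^ 2 * x ^ 4 - 24 * π * x ^ 2 + 3| * Real.exp (-(π * x ^ 2))
      ≤ (16 * (π * x ^ 2) ^ 2 + 24 * (π * x ^ 2) + 3) * Real.exp (-(π * x ^ 2)) :=
        mul_le_mul_of_nonneg_right hP hepos.le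
    _ = 16 * ((π * x ^ 2) ^ 2 * Real.exp (-(π * x ^ 2))) + 24 * ((π * x ^ 2) * Real.exp (-(π * x ^ 2)))
        + 3 * Real.exp (-(π * x ^ 2)) := by ring
    _ ≤ 16 * 2 + 24 * 1 + 3 * 1 := by gcongr
    _ = 59 := by norm_num

/-- `g` bounded, continuous and integrable ⇒ `g²` integrable. [folklore] -/
theorem integrable_sq_of_abs_le {g : ℝ → ℝ} (hgc : Continuous g) {G : ℝ} (hG : ∀ x, |g x| ≤ G)
    (Ig : Integrable g) : Integrable fun x ↦ g x ^ 2 := by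
  refine (Ig.abs.const_mul G).mono' (hgc.pow 2).aestronglyMeasurable (Eventually.of_forall fun x ↦ ?_)
  rw [Real.norm_eq_abs, abs_of_nonneg (sq_nonneg _), sq, ← abs_mul_abs_self]
  exact mul_le_mul_of_nonneg_right (hG x) (abs_nonneg _)

/-- `∫_0^∞ h_0² > 0`. [folklore] -/
theorem integral_sq_hermiteH0_pos : 0 < ∫ x in Ioi (0 : ℝ), hermiteH0 x ^ 2 := by
  have hi := (integrable_sq_of_abs_le continuous_hermiteH0 abs_hermiteH0_le integrable_hermiteH0)
  rw [setIntegral_pos_iff_support_of_nonneg_ae (Eventually.of_forall fun x ↦ sq_nonneg (hermiteH0 x))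
    hi.integrableOn]
  have hs : Function.support (fun x ↦ hermiteH0 x ^ 2) = univ := by
    ext x; simp [(hermiteH0_pos x).ne']
  rw [hs, univ_inter, Real.volume_Ioi]
  exact ENNReal.zero_lt_top

/-- `h_4(x) > 0` for `x ≥ 2`. [folklore] -/
theorem hermiteH4_pos_of_two_le {x : ℝ} (hx : 2 ≤ x) : 0 < hermiteH4 x := by
  have hA := prolateGuessA_pos
  have hπ := Real.pi_gt_three
  have hx2 : 4 ≤ x ^ 2 := by nlinarith
  have hP : 0 < 16 * π ^ 2 * x ^ 4 - 24 * π * x ^ 2 + 3 := by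
    have : 0 ≤ 8 * π * x ^ 2 * (2 * π * x ^ 2 - 3) := by
      have : 0 ≤ 2 * π * x ^ 2 - 3 := by nlinarith
      positivity
    nlinarith
  unfold hermiteH4
  exact div_pos (mul_pos hP (Real.exp_pos _)) (by positivity)

/-- `∫_0^∞ h_4² > 0`. [folklore] -/
theorem integral_sq_hermiteH4_pos : 0 < ∫ x in Ioi (0 : ℝ), hermiteH4 x ^ 2 := by
  have hi := (integrable_sq_of_abs_le continuous_hermiteH4 abs_hermiteH4_le integrable_hermiteH4)
  rw [setIntegral_pos_iff_support_of_nonneg_ae (Eventually.of_forall fun x ↦ sq_nonneg (hermiteH4 x))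
    hi.integrableOn]
  have hs : Ioi (2 : ℝ) ⊆ Function.support (fun x ↦ hermiteH4 x ^ 2) ∩ Ioi 0 := fun x hx ↦
    ⟨by simp [(hermiteH4_pos_of_two_le (le_of_lt hx)).ne'], by simp only [mem_Ioi] at hx ⊢; linarith⟩
  refine lt_of_lt_of_le ?_ (measure_mono hs)
  rw [Real.volume_Ioi]
  exact ENNReal.zero_lt_top

/-- `(x²h_0′)′ = 2^{1/4}(4π²x⁴ − 6πx²)e^{−πx²}` is integrable. [folklore] -/
theorem integrableOn_abs_q_hermiteH0 : IntegrableOn (fun x ↦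
    |2 * x * hermiteH0' x + x ^ 2 * ((4 * π ^ 2 * x ^ 2 - 2 * π) * hermiteH0 x)|) (Ioi 0) := by
  have h : Integrable fun x : ℝ ↦ (2 : ℝ) ^ ((1 : ℝ) / 4) *
      ((4 * π ^ 2) * (x ^ 4 * Real.exp (-π * x ^ 2)) - (6 * π) * (x ^ 2 * Real.exp (-π * x ^ 2))) :=
    (((integrable_pow_mul_exp_neg_pi_mul_sq 4).const_mul _).sub
      ((integrable_pow_mul_exp_neg_pi_mul_sq 2).const_mul _)).const_mul _
  refine h.abs.integrableOn.congr_fun (fun x _ ↦ ?_) measurableSet_Ioi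
  simp only [hermiteH0, hermiteH0']
  congr 1
  ring

/-- `(x²h_4′)′ = (64π⁴x⁸ − 448π³x⁶ + 668π²x⁴ − 162πx²)e^{−πx²}/(16A)` is integrable. [folklore] -/
theorem integrableOn_abs_q_hermiteH4 : IntegrableOn (fun x ↦
    |2 * x * hermiteH4' x + x ^ 2 * ((4 * π ^ 2 * x ^ 2 - 18 * π) * hermiteH4 x)|) (Ioi 0) := by
  have h : Integrable fun x : ℝ ↦ ((64 * π ^ 4) * (x ^ 8 * Real.exp (-π * x ^ 2))
      - (448 * π ^ 3) * (x ^ 6 * Real.exp (-π * x ^ 2)) + (668 * π ^ 2) * (x ^ 4 * Real.exp (-π * x ^ 2))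
      - (162 * π) * (x ^ 2 * Real.exp (-π * x ^ 2))) / (16 * prolateGuessA) :=
    (((((integrable_pow_mul_exp_neg_pi_mul_sq 8).const_mul _).sub
      ((integrable_pow_mul_exp_neg_pi_mul_sq 6).const_mul _)).add
      ((integrable_pow_mul_exp_neg_pi_mul_sq 4).const_mul _)).sub
      ((integrable_pow_mul_exp_neg_pi_mul_sq 2).const_mul _)).div_const _
  refine h.abs.integrableOn.congr_fun (fun x _ ↦ ?_) measurableSet_Ioi
  simp only [hermiteH4, hermiteH4']
  congr 1
  field_simp
  ring

/-- `|h_4′(x)|(1+x)` is integrable on `(0, ∞)` (dominated by a polynomial times the Gaussian).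
[folklore] -/
theorem integrableOn_abs_hermiteH4'_mul : IntegrableOn (fun x ↦ |hermiteH4' x| * (1 + x)) (Ioi 0) := by
  have hA := prolateGuessA_pos
  have hB : Integrable fun x : ℝ ↦ ((32 * π ^ 3) * (x ^ 5 * Real.exp (-π * x ^ 2))
      + (32 * π ^ 3) * (x ^ 6 * Real.exp (-π * x ^ 2)) + (112 * π ^ 2) * (x ^ 3 * Real.exp (-π * x ^ 2))
      + (112 * π ^ 2) * (x ^ 4 * Real.exp (-π * x ^ 2)) + (54 * π) * (x ^ 1 * Real.exp (-π * x ^ 2))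
      + (54 * π) * (x ^ 2 * Real.exp (-π * x ^ 2))) / (16 * prolateGuessA) :=
    (((((((integrable_pow_mul_exp_neg_pi_mul_sq 5).const_mul _).add
      ((integrable_pow_mul_exp_neg_pi_mul_sq 6).const_mul _)).add
      ((integrable_pow_mul_exp_neg_pi_mul_sq 3).const_mul _)).add
      ((integrable_pow_mul_exp_neg_pi_mul_sq 4).const_mul _)).add
      ((integrable_pow_mul_exp_neg_pi_mul_sq 1).const_mul _)).add
      ((integrable_pow_mul_exp_neg_pi_mul_sq 2).const_mul _)).div_const _
  refine hB.integrableOn.mono' ((continuous_hermiteH4'.abs.mul (by fun_prop)).aestronglyMeasurable)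
    ?_
  filter_upwards [ae_restrict_mem measurableSet_Ioi] with x hx
  have hx0 : 0 ≤ x := le_of_lt hx
  rw [Real.norm_eq_abs, abs_of_nonneg (mul_nonneg (abs_nonneg _) (by linarith))]
  have hP : |-32 * π ^ 3 * x ^ 5 + 112 * π ^ 2 * x ^ 3 - 54 * π * x|
      ≤ 32 * π ^ 3 * x ^ 5 + 112 * π ^ 2 * x ^ 3 + 54 * π * x := by
    refine (abs_sub _ _).trans ?_
    refine (add_le_add (abs_add_le _ _) le_rfl).trans (le_of_eq ?_)
    rw [show -32 * π ^ 3 * x ^ 5 = -(32 * π ^ 3 * x ^ 5) by ring, abs_neg,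
      abs_of_nonneg (by positivity), abs_of_nonneg (by positivity), abs_of_nonneg (by positivity)]
  have habs : |hermiteH4' x| ≤ (32 * π ^ 3 * x ^ 5 + 112 * π ^ 2 * x ^ 3 + 54 * π * x)
      * Real.exp (-π * x ^ 2) / (16 * prolateGuessA) := by
    unfold hermiteH4'
    rw [abs_div, abs_of_pos (by positivity : (0 : ℝ) < 16 * prolateGuessA), abs_mul,
      abs_of_pos (Real.exp_pos _)]
    gcongr
  calc |hermiteH4' x| * (1 + x)
      ≤ (32 * π ^ 3 * x ^ 5 + 112 * π ^ 2 * x ^ 3 + 54 * π * x) * Real.exp (-π * x ^ 2)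
          / (16 * prolateGuessA) * (1 + x) := mul_le_mul_of_nonneg_right habs (by linarith)
    _ = _ := by field_simp; ring

/-- The ground prolate function `h_{0,λ}` is positive on `(−λ, λ)` (no zero there, `h_{0,λ}(0) > 0`).
[cite: Connes2026Letter, §6.3] -/
theorem IsProlateFunction.pos_of_zero {lam : ℝ} {f : ℝ → ℝ} (hf : IsProlateFunction lam 0 f)
    {x : ℝ} (hx : x ∈ Ioo (-lam) lam) : 0 < f x := by
  have hlam := hf.lam_pos
  have hempty : {x : ℝ | x ∈ Ioo (-lam) lam ∧ f x = 0} = ∅ :=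
    (Set.ncard_eq_zero hf.zeros_finite).mp hf.zeros_card
  have hne : ∀ y ∈ Ioo (-lam) lam, f y ≠ 0 := by
    intro y hy hfy
    have hmem : y ∈ {x : ℝ | x ∈ Ioo (-lam) lam ∧ f x = 0} := ⟨hy, hfy⟩
    rw [hempty] at hmem
    exact hmem
  by_contra h
  have hfx : f x ≤ 0 := le_of_not_gt h
  have hcont : ContinuousOn f (Icc (-lam) lam) := hf.contDiffOn.continuousOn
  rcases le_total 0 x with h0x | hx0
  · -- IVT on `[0, x]`
    have hc : ContinuousOn f (Icc 0 x) := hcont.mono (Icc_subset_Icc (by linarith) hx.2.le)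
    obtain ⟨c, hc1, hc2⟩ := intermediate_value_Icc' h0x hc ⟨hfx, hf.pos_zero.le⟩
    exact hne c ⟨by linarith [hc1.1], lt_of_le_of_lt hc1.2 hx.2⟩ hc2
  · have hc : ContinuousOn f (Icc x 0) := hcont.mono (Icc_subset_Icc hx.1.le hlam.le)
    obtain ⟨c, hc1, hc2⟩ := intermediate_value_Icc hx0 hc ⟨hfx, hf.pos_zero.le⟩
    exact hne c ⟨lt_of_lt_of_le hx.1 hc1.1, by linarith [hc1.2]⟩ hc2

/-- (S₀) ⇒ (W₀): `λ·max|h_{0,λ} − h_0| → 0` implies `∫_0^λ|h_{0,λ}′ − h_0′|(1+x) → 0`.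
[cite: ConnesConsaniMoscovici2025, Lemma 7.2] -/
theorem integral_abs_deriv_sub_hermiteH0'_le
    (hS : ∀ η : ℝ, 0 < η → ∃ Λ : ℝ, ∀ lam : ℝ, Λ ≤ lam → ∀ f : ℝ → ℝ,
      IsProlateFunction lam 0 f → ∀ x ∈ Icc (-lam) lam, lam * |f x - hermiteH0 x| ≤ η)
    (ε : ℝ) (hε : 0 < ε) :
    ∃ Λ : ℝ, ∀ lam : ℝ, Λ ≤ lam → ∀ f : ℝ → ℝ, IsProlateFunction lam 0 f →
      (∫ x in (0 : ℝ)..lam, |deriv f x - hermiteH0' x| * (1 + x)) ≤ ε :=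
  integral_abs_deriv_sub_le_of_supLimit hasDerivAt_hermiteH0 hasDerivAt_hermiteH0' hermiteH0'_zero
    abs_hermiteH0_le integrable_hermiteH0 integrableOn_abs_hermiteH0'_mul integrableOn_abs_q_hermiteH0
    integral_sq_hermiteH0_pos tendsto_mul_hermiteH0_atTop hS le_rfl (Λ₀ := 0)
    (fun lam _ f hf x hx ↦ (hf.pos_of_zero ⟨by linarith [hx.1, hf.lam_pos], hx.2⟩).le) ε hε

/-- (S₄) + zero-free tail ⇒ (W₄): `λ·max|h_{4,λ} − h_4| → 0` and `h_{4,λ} ≥ 0` on `[X₀, λ)`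
imply `∫_0^λ|h_{4,λ}′ − h_4′|(1+x) → 0`. [cite: ConnesConsaniMoscovici2025, Lemma 7.2] -/
theorem integral_abs_deriv_sub_hermiteH4'_le
    (hS : ∀ η : ℝ, 0 < η → ∃ Λ : ℝ, ∀ lam : ℝ, Λ ≤ lam → ∀ f : ℝ → ℝ,
      IsProlateFunction lam 4 f → ∀ x ∈ Icc (-lam) lam, lam * |f x - hermiteH4 x| ≤ η)
    {X₀ Λ₀ : ℝ} (hX₀ : 0 ≤ X₀) (hZ : ∀ lam : ℝ, Λ₀ ≤ lam → ∀ f : ℝ → ℝ,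
      IsProlateFunction lam 4 f → ∀ x ∈ Ico X₀ lam, 0 ≤ f x) (ε : ℝ) (hε : 0 < ε) :
    ∃ Λ : ℝ, ∀ lam : ℝ, Λ ≤ lam → ∀ f : ℝ → ℝ, IsProlateFunction lam 4 f →
      (∫ x in (0 : ℝ)..lam, |deriv f x - hermiteH4' x| * (1 + x)) ≤ ε :=
  integral_abs_deriv_sub_le_of_supLimit hasDerivAt_hermiteH4 hasDerivAt_hermiteH4' hermiteH4'_zero
    abs_hermiteH4_le integrable_hermiteH4 integrableOn_abs_hermiteH4'_mul integrableOn_abs_q_hermiteH4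
    integral_sq_hermiteH4_pos tendsto_mul_hermiteH4_atTop hS hX₀ hZ ε hε

/-- (Sₙ) from the rate: `max|f − g| ≤ C/λ²` gives `λ·max|f − g| ≤ C/λ → 0`. [folklore] -/
theorem supNorm_mul_tendsto_of_rate {n : ℕ} {g : ℝ → ℝ} {C Λs : ℝ}
    (hS : ∀ lam : ℝ, Λs ≤ lam → ∀ f : ℝ → ℝ, IsProlateFunction lam n f →
      ∀ x ∈ Icc (-lam) lam, |f x - g x| ≤ C / lam ^ 2) (ε : ℝ) (hε : 0 < ε) :
    ∃ Λ : ℝ, ∀ lam : ℝ, Λ ≤ lam → ∀ f : ℝ → ℝ, IsProlateFunction lam n f →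
      ∀ x ∈ Icc (-lam) lam, lam * |f x - g x| ≤ ε := by
  refine ⟨max Λs (max C 0 / ε + 1), fun lam hlam f hf x hx ↦ ?_⟩
  have hlam0 := hf.lam_pos
  have hΛ : Λs ≤ lam := (le_max_left _ _).trans hlam
  have hC : max C 0 / ε + 1 ≤ lam := (le_max_right _ _).trans hlam
  have h1 : lam * |f x - g x| ≤ max C 0 / lam := by
    calc lam * |f x - g x| ≤ lam * (C / lam ^ 2) :=
          mul_le_mul_of_nonneg_left (hS lam hΛ f hf x hx) hlam0.le
      _ = C / lam := by field_simp
      _ ≤ max C 0 / lam := div_le_div_of_nonneg_right (le_max_left _ _) hlam0.le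
  have h2 : max C 0 / lam ≤ ε := by
    rw [div_le_iff₀ hlam0]
    have : max C 0 / ε ≤ lam := by linarith
    rw [div_le_iff₀ hε] at this
    linarith
  exact h1.trans h2

/-- `h_4(1/2) < 0` (`π² − 6π + 3 < 0`). [folklore] -/
theorem hermiteH4_half_neg : hermiteH4 (1 / 2) < 0 := by
  have hA := prolateGuessA_pos
  have h3 := Real.pi_gt_three
  have h4 := Real.pi_lt_d2
  have hP : 16 * π ^ 2 * (1 / 2 : ℝ) ^ 4 - 24 * π * (1 / 2 : ℝ) ^ 2 + 3 < 0 := by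
    nlinarith [mul_pos (sub_pos.2 h3) (sub_pos.2 h4)]
  unfold hermiteH4
  exact div_neg_of_neg_of_pos (mul_neg_of_neg_of_pos hP (Real.exp_pos _)) (by positivity)

/-- `h_4(1) > 0` (`16π² − 24π + 3 > 0`). [folklore] -/
theorem hermiteH4_one_pos : 0 < hermiteH4 1 := by
  have hA := prolateGuessA_pos
  have h3 := Real.pi_gt_three
  have hP : 0 < 16 * π ^ 2 * (1 : ℝ) ^ 4 - 24 * π * (1 : ℝ) ^ 2 + 3 := by nlinarith
  unfold hermiteH4
  exact div_pos (mul_pos hP (Real.exp_pos _)) (by positivity)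

/-- **The zeros of `h_{4,λ}` stay in `(−1, 1)`.**  If `|h_{4,λ} − h_4| ≤ δ` on `[−λ, λ]` with
`δ < min(−h_4(1/2), h_4(1))` and `λ > 1`, then `h_{4,λ} ≥ 0` on `[1, λ)`: the sign pattern
`h_{4,λ}(0) > 0 > h_{4,λ}(±1/2)`, `h_{4,λ}(±1) > 0` already produces four zeros in `(−1, 1)`
(intermediate values, evenness `IsProlateFunction.even`), and a negative value on `[1, λ)` would
produce a fifth, contradicting `zeros_card = 4`. [cite: ConnesConsaniMoscovici2025, Lemma 7.2] -/
theorem IsProlateFunction.nonneg_of_four {lam : ℝ} {f : ℝ → ℝ} (hf : IsProlateFunction lam 4 f)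
    {δ : ℝ} (hδ : ∀ x ∈ Icc (-lam) lam, |f x - hermiteH4 x| ≤ δ)
    (hδ1 : δ < -hermiteH4 (1 / 2)) (hδ2 : δ < hermiteH4 1) (hlam : 1 < lam)
    {x : ℝ} (hx : x ∈ Ico 1 lam) : 0 ≤ f x := by
  by_contra hneg
  have hfx : f x < 0 := lt_of_not_ge hneg
  have hcont : ContinuousOn f (Icc (-lam) lam) := hf.contDiffOn.continuousOn
  have f0 : 0 < f 0 := hf.pos_zero
  have fh : f (1 / 2) < 0 := by
    have := hδ (1 / 2) ⟨by linarith, by linarith⟩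
    have := le_abs_self (f (1 / 2) - hermiteH4 (1 / 2))
    linarith
  have f1 : 0 < f 1 := by
    have := hδ 1 ⟨by linarith, hlam.le⟩
    have := neg_abs_le (f 1 - hermiteH4 1)
    linarith
  obtain ⟨c₁, hc₁, hfc₁⟩ := intermediate_value_Ioo' (by norm_num : (0 : ℝ) ≤ 1 / 2)
    (hcont.mono (Icc_subset_Icc (by linarith) (by linarith))) ⟨fh, f0⟩
  obtain ⟨c₂, hc₂, hfc₂⟩ := intermediate_value_Ioo (by norm_num : (1 / 2 : ℝ) ≤ 1)
    (hcont.mono (Icc_subset_Icc (by linarith) hlam.le)) ⟨fh, f1⟩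
  obtain ⟨c₅, hc₅, hfc₅⟩ := intermediate_value_Ioo' hx.1
    (hcont.mono (Icc_subset_Icc (by linarith) hx.2.le)) ⟨hfx, f1⟩
  have he := hf.even
  -- five distinct zeros in `(−λ, λ)`
  set Z := {x : ℝ | x ∈ Ioo (-lam) lam ∧ f x = 0} with hZ
  let T : Finset ℝ := {c₁, c₂, -c₁, -c₂, c₅}
  have hTZ : (↑T : Set ℝ) ⊆ Z := by
    intro y hy
    simp only [T, Finset.coe_insert, Finset.coe_singleton, mem_insert_iff, mem_singleton_iff] at hy
    rcases hy with rfl | rfl | rfl | rfl | rfl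
    · exact ⟨⟨by linarith [hc₁.1], by linarith [hc₁.2]⟩, hfc₁⟩
    · exact ⟨⟨by linarith [hc₂.1], by linarith [hc₂.2]⟩, hfc₂⟩
    · exact ⟨⟨by linarith [hc₁.2], by linarith [hc₁.1]⟩, by rw [he]; exact hfc₁⟩
    · exact ⟨⟨by linarith [hc₂.2], by linarith [hc₂.1]⟩, by rw [he]; exact hfc₂⟩
    · exact ⟨⟨by linarith [hc₅.1], lt_trans hc₅.2 hx.2⟩, hfc₅⟩
  have hTcard : T.card = 5 := by
    have n12 : c₁ ≠ c₂ := by intro h; linarith [hc₁.2, hc₂.1]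
    have n13 : c₁ ≠ -c₁ := by intro h; linarith [hc₁.1]
    have n14 : c₁ ≠ -c₂ := by intro h; linarith [hc₁.1, hc₂.1]
    have n15 : c₁ ≠ c₅ := by intro h; linarith [hc₁.2, hc₅.1]
    have n23 : c₂ ≠ -c₁ := by intro h; linarith [hc₁.1, hc₂.1]
    have n24 : c₂ ≠ -c₂ := by intro h; linarith [hc₂.1]
    have n25 : c₂ ≠ c₅ := by intro h; linarith [hc₂.2, hc₅.1]
    have n34 : -c₁ ≠ -c₂ := by intro h; linarith [hc₁.2, hc₂.1]
    have n35 : -c₁ ≠ c₅ := by intro h; linarith [hc₁.1, hc₅.1]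
    have n45 : -c₂ ≠ c₅ := by intro h; linarith [hc₂.1, hc₅.1]
    simp only [T, Finset.card_insert_of_notMem, Finset.mem_insert, Finset.mem_singleton, n12, n13, n14,
      n15, n23, n24, n25, n34, n35, n45, or_self, not_false_eq_true, Finset.card_singleton]
  have h5 : 5 ≤ Z.ncard := by
    rw [← hTcard, ← Set.ncard_coe_finset]
    exact Set.ncard_le_ncard hTZ hf.zeros_finite
  rw [hf.zeros_card] at h5
  omega

/-- `h_{4,λ} ≥ 0` on `[1, λ)` for `λ` large, from (S₄). [cite: ConnesConsaniMoscovici2025, Lemma 7.2] -/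
theorem zeroFree_of_supLimit_four
    (hS4 : ∀ η : ℝ, 0 < η → ∃ Λ : ℝ, ∀ lam : ℝ, Λ ≤ lam → ∀ f : ℝ → ℝ,
      IsProlateFunction lam 4 f → ∀ x ∈ Icc (-lam) lam, lam * |f x - hermiteH4 x| ≤ η) :
    ∃ Λ₀ : ℝ, ∀ lam : ℝ, Λ₀ ≤ lam → ∀ f : ℝ → ℝ, IsProlateFunction lam 4 f →
      ∀ x ∈ Ico 1 lam, 0 ≤ f x := by
  set m : ℝ := min (-hermiteH4 (1 / 2)) (hermiteH4 1) with hm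
  have hm0 : 0 < m := lt_min (by linarith [hermiteH4_half_neg]) hermiteH4_one_pos
  obtain ⟨Λs, hΛS⟩ := hS4 (m / 2) (by positivity)
  refine ⟨max Λs 2, fun lam hlam f hf x hx ↦ ?_⟩
  have hΛ : Λs ≤ lam := (le_max_left _ _).trans hlam
  have h2 : 2 ≤ lam := (le_max_right _ _).trans hlam
  have hδ : ∀ y ∈ Icc (-lam) lam, |f y - hermiteH4 y| ≤ m / 2 := by
    intro y hy
    have h := hΛS lam hΛ f hf y hy
    nlinarith [abs_nonneg (f y - hermiteH4 y)]
  have hδm : m / 2 < m := by linarith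
  exact hf.nonneg_of_four hδ (lt_of_lt_of_le hδm (min_le_left _ _))
    (lt_of_lt_of_le hδm (min_le_right _ _)) (by linarith) hx

/-- **Connes' Fact 6.4 from the sup-norm asymptotics (S₀), (S₄) alone.**  If
`λ·max_{[−λ,λ]}|h_{n,λ} − h_n| → 0` for `n = 0` and `n = 4` (hypotheses `hS0`, `hS4`, the same as in
`prolateGuess_tendsto_riemannXi_of_hermiteLimit`), then `4·𝓜(E(h_λ)·1_{[λ⁻¹,λ]})(s) → Ξ(1/2 + s)`
uniformly on `|Re s| ≤ α₀ < 1/2` (`prolateGuess_tendsto_riemannXi`): the derivative-level hypotheses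
(W₀), (W₄) of `…_of_hermiteLimit` are CONSEQUENCES of (S₀), (S₄) (this file).  THIS IS NOT AN RH
STATEMENT. [cite: ConnesConsaniMoscovici2025, Lemma 7.2, Lemma 7.3] -/
theorem prolateGuess_tendsto_riemannXi_of_supLimit
    (hS0 : ∀ η : ℝ, 0 < η → ∃ Λ : ℝ, ∀ lam : ℝ, Λ ≤ lam → ∀ f : ℝ → ℝ,
      IsProlateFunction lam 0 f → ∀ x ∈ Icc (-lam) lam, lam * |f x - hermiteH0 x| ≤ η)
    (hS4 : ∀ η : ℝ, 0 < η → ∃ Λ : ℝ, ∀ lam : ℝ, Λ ≤ lam → ∀ f : ℝ → ℝ,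
      IsProlateFunction lam 4 f → ∀ x ∈ Icc (-lam) lam, lam * |f x - hermiteH4 x| ≤ η) :
    prolateGuess_tendsto_riemannXi := by
  obtain ⟨Λ', hZ4⟩ := zeroFree_of_supLimit_four hS4
  exact prolateGuess_tendsto_riemannXi_of_hermiteLimit hS0 hS4
    (integral_abs_deriv_sub_hermiteH0'_le hS0) (integral_abs_deriv_sub_hermiteH4'_le hS4 zero_le_one hZ4)

/-- **Connes' Fact 6.4 from CCM25 Lemma 7.2(i).**  If the normalised prolate spheroidal functions
satisfy the sup-norm asymptotics with rate `max_{[−λ,λ]}|h_{n,λ} − h_n| ≤ C/λ²` for `n = 0, 4`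
(Connes–Consani–Moscovici 2025, Lemma 7.2(i), eq. (7.7), from Meixner–Schäfke 1954 §3.2 Satz 9;
hypotheses `hS0`, `hS4`, with the tree's `hermiteH0 = h_0 = 2^{1/4}e^{−πx²}`,
`hermiteH4 = h_4`, `A(h_4 − ρh_0) = h`), then `4·𝓜(E(h_λ)·1_{[λ⁻¹,λ]})(s) → Ξ(1/2 + s)`
uniformly on `|Re s| ≤ α₀ < 1/2` (`prolateGuess_tendsto_riemannXi`, Connes 2026 Fact 6.4 =
CCM25 Lemma 7.3).  Chain: this file ((S-rate) ⇒ (Sₙ) ⇒ eigenvalue bound, zero confinement, (Wₙ))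
→ `prolateGuess_tendsto_riemannXi_of_hermiteLimit` → `prolateGuess_tendsto_riemannXi_of_deriv_tendsto`
→ the `W^{1,1}` error bound `norm_four_mul_prolateGuessMellin_sub_riemannXi_le_W11`.  The only
remaining input is the published sup-norm asymptotics of the prolate spheroidal wave functions.
THIS IS NOT AN RH STATEMENT and nothing here uses RH.
[cite: ConnesConsaniMoscovici2025, Lemma 7.2, Lemma 7.3] -/
theorem prolateGuess_tendsto_riemannXi_of_supNorm {C₀ Λ₀ C₄ Λ₄ : ℝ}
    (hS0 : ∀ lam : ℝ, Λ₀ ≤ lam → ∀ f : ℝ → ℝ, IsProlateFunction lam 0 f →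
      ∀ x ∈ Icc (-lam) lam, |f x - hermiteH0 x| ≤ C₀ / lam ^ 2)
    (hS4 : ∀ lam : ℝ, Λ₄ ≤ lam → ∀ f : ℝ → ℝ, IsProlateFunction lam 4 f →
      ∀ x ∈ Icc (-lam) lam, |f x - hermiteH4 x| ≤ C₄ / lam ^ 2) :
    prolateGuess_tendsto_riemannXi :=
  prolateGuess_tendsto_riemannXi_of_supLimit (supNorm_mul_tendsto_of_rate hS0)
    (supNorm_mul_tendsto_of_rate hS4)

end Literature.NumberTheory.LFunctions
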